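import Mathlib.GroupTheory.Abelianization.Defs
import Mathlib.Tactic.Abel
import Summits.SmoothPoincare4.SmoothPoincare4.Theorems.CongruenceShadowsNilpotentShadowsStandardJohnsonClassTwo
import Summits.SmoothPoincare4.SmoothPoincare4.Theorems.CongruenceShadowsNilpotentShadowsStandardJohnsonSubstAut
import HarnessLib

/-!
# Johnson generators IV: the two explicit realisers (helper for stub `stub_johnsonGenerators`)

Line `saturated-torsor-descent`, crux `CongruenceShadows.NilpotentShadowsStandard`
(item stmt-SmoothPoincare4-14594).  Two IA-computations in the presented `S_{n+3}` modulo `γ₃`: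
* the genus-1 BOUNDING-PAIR map on handles `0, 1` (`x₀ ↦ c₀ b₁⁻¹ x₀ b₁ c₀⁻¹`,
  `a₁ ↦ c₀ b₁⁻¹ c₀⁻¹ b₁ a₁ c₀⁻¹`, `b₁ ↦ c₀ b₁ c₀⁻¹`, Johnson 1980 §4) is IA and realises
  `(b₀, a₀, b₁)` (`τ₁ = a₀ ∧ b₀ ∧ b₁` up to order): registered helper `helper_johnsonBoundingPair`;
* a handle-MIXING automorphism `μ` (`a₀ ↦ a₀a₁`, `b₀ ↦ a₁⁻¹b₀a₁`, `a₁ ↦ a₁⁻¹b₀a₁b₁⁻¹`,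
  `b₁ ↦ b₁b₀⁻¹a₁`, fixing `c₀c₁` on the nose) turns a realiser `ψ` of `(b₀, a₀, b_k)` into the
  realiser `(μψμ⁻¹)ψ⁻¹` of the TYPE II triple `(b₀, a₁, b_k)` (`realise_mix`), computed letter by
  letter in `S ⧸ γ₃` with the class-2 calculus.
No definitions; `linter.unusedSimpArgs` is off for the shared simp sets of the word computations.
-/

set_option linter.dupNamespace false
set_option linter.unusedSimpArgs false

open Subgroup Literature.Topology.FourManifolds
open scoped commutatorElement

namespace Summit.SmoothPoincare4.SmoothPoincare4.Theorems.NilpotentShadowsStandard.SaturatedTorsorDescent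

/-! ## The genus-1 bounding-pair map on handles `0, 1`: a realiser of `(b₀, a₀, b₁)` -/

section BoundingPair

variable {n : ℕ}

/-- **The bounding-pair substitution** `x₀ ↦ c₀ b₁⁻¹ x₀ b₁ c₀⁻¹` (`x = a, b`),
`a₁ ↦ c₀ b₁⁻¹ c₀⁻¹ b₁ a₁ c₀⁻¹`, `b₁ ↦ c₀ b₁ c₀⁻¹` (`c₀ = [a₀, b₀]`; `= ι_{c₀} ∘ T_γ T_δ⁻¹`,
`γ = ∂(handle 0) # b₁`, `δ = b₁`) and its inverse define an automorphism `ψ` of the presented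
`S_{n+3}` (the block identity `ψ(c₀) ψ(c₁) = c₀ c₁` holds in the free group).
[cite: Johnson1980AbelianQuotient, §4] -/
theorem exists_bpAut (n : ℕ) : ∃ ψ : SurfaceGroup (n + 3) ≃* SurfaceGroup (n + 3),
    (∀ w, ψ (PresentedGroup.mk _ w) = PresentedGroup.mk _ (FreeGroup.lift
      (fun x : Fin (n + 3) × Bool =>
      if x.1 = 0 then ⁅genA (0 : Fin (n + 3)), genB 0⁆ * (genB 1)⁻¹ * FreeGroup.of x * genB 1 * (⁅genA (0 : Fin (n + 3)), genB 0⁆)⁻¹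
      else if x = (1, false) then ⁅genA (0 : Fin (n + 3)), genB 0⁆ * (genB 1)⁻¹ * (⁅genA (0 : Fin (n + 3)), genB 0⁆)⁻¹ * genB 1 * genA 1 * (⁅genA (0 : Fin (n + 3)), genB 0⁆)⁻¹
      else if x = (1, true) then ⁅genA (0 : Fin (n + 3)), genB 0⁆ * genB 1 * (⁅genA (0 : Fin (n + 3)), genB 0⁆)⁻¹
      else FreeGroup.of x) w)) ∧
    (∀ w, ψ.symm (PresentedGroup.mk _ w) = PresentedGroup.mk _ (FreeGroup.lift
      (fun x : Fin (n + 3) × Bool =>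
      if x.1 = 0 then genB 1 * (⁅genA (0 : Fin (n + 3)), genB 0⁆)⁻¹ * FreeGroup.of x * ⁅genA (0 : Fin (n + 3)), genB 0⁆ * (genB 1)⁻¹
      else if x = (1, false) then
        genB 1 * (⁅genA (0 : Fin (n + 3)), genB 0⁆)⁻¹ * (genB 1)⁻¹ * ⁅genA (0 : Fin (n + 3)), genB 0⁆ * genA 1 * genB 1 * ⁅genA (0 : Fin (n + 3)), genB 0⁆ * (genB 1)⁻¹
      else if x = (1, true) then genB 1 * (⁅genA (0 : Fin (n + 3)), genB 0⁆)⁻¹ * genB 1 * ⁅genA (0 : Fin (n + 3)), genB 0⁆ * (genB 1)⁻¹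
      else FreeGroup.of x) w)) := by
  have h10 := fin_one_ne_zero n
  refine exists_aut_of_subst _ _
    (mk_surfaceRelator_of_eq (lift_surfaceRelator_of_block _ (by simp only [commutatorElement_def, map_mul, map_inv, FreeGroup.lift_apply_of, genA, genB, if_true, if_false, h10, Prod.mk.injEq, and_true, and_false, Bool.false_eq_true, Bool.true_eq_false, true_and, false_and]; group)
      (fun j ε h0 h1 => by simp [h0, h1])))
    (mk_surfaceRelator_of_eq (lift_surfaceRelator_of_block _ (by simp only [commutatorElement_def, map_mul, map_inv, FreeGroup.lift_apply_of, genA, genB, if_true, if_false, h10, Prod.mk.injEq, and_true, and_false, Bool.false_eq_true, Bool.true_eq_false, true_and, false_and]; group)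
      (fun j ε h0 h1 => by simp [h0, h1])))
    (fun x => ?_) (fun x => ?_) <;>
  · obtain ⟨j, ε⟩ := x
    by_cases h0 : j = 0
    · subst h0
      cases ε <;> simp only [commutatorElement_def, map_mul, map_inv, FreeGroup.lift_apply_of, genA, genB, if_true, if_false, h10, Prod.mk.injEq, and_true, and_false, Bool.false_eq_true, Bool.true_eq_false, true_and, false_and, PresentedGroup.of] <;> group
    by_cases h1 : j = 1
    · subst h1
      cases ε <;> simp only [commutatorElement_def, map_mul, map_inv, FreeGroup.lift_apply_of, genA, genB, if_true, if_false, h10, Prod.mk.injEq, and_true, and_false, Bool.false_eq_true, Bool.true_eq_false, true_and, false_and, PresentedGroup.of] <;> group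
    · simp [h0, h1, PresentedGroup.of]

/-- **The bounding-pair map realises `(b₀, a₀, b₁)`**: it is IA with
`ψ(a₀)a₀⁻¹ ≡ ⁅a₀, b₁⁆`, `ψ(b₀)b₀⁻¹ ≡ ⁅b₁, b₀⁆⁻¹`, `ψ(a₁)a₁⁻¹ ≡ ⁅b₀, a₀⁆`, `ψ(b₁)b₁⁻¹ ≡ 1`
modulo `γ₃`, i.e. `τ₁(ψ) = b₀ ∧ a₀ ∧ b₁`. [cite: Johnson1980AbelianQuotient, Lemma 4B] -/
theorem realise_bp (n : ℕ) :
    ∃ ψ : SurfaceGroup (n + 3) ≃* SurfaceGroup (n + 3), (∀ s : SurfaceGroup (n + 3), ψ s * s⁻¹ ∈ (⊤ : Subgroup (SurfaceGroup (n + 3))).lowerCentralSeries 1) ∧ ∀ x : Fin (n + 3) × Bool, ψ (PresentedGroup.of x : SurfaceGroup (n + 3)) * (PresentedGroup.of x : SurfaceGroup (n + 3))⁻¹ * (⁅(PresentedGroup.of ((0 : Fin (n + 3)), false) : SurfaceGroup (n + 3)), (PresentedGroup.of ((1 : Fin (n + 3)), true) : SurfaceGroup (n + 3))⁆ ^ (if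 x.1 = ((0 : Fin (n + 3)), true).1 ∧ x.2 = false ∧ ((0 : Fin (n + 3)), true).2 = true then (1 : ℤ) else if x.1 = ((0 : Fin (n + 3)), true).1 ∧ x.2 = true ∧ ((0 : Fin (n + 3)), true).2 = false then (-1 : ℤ) else 0) * ⁅(PresentedGroup.of ((1 : Fin (n + 3)), true) : SurfaceGroup (n + 3)), (PresentedGroup.of ((0 : Fin (n + 3)), true) : SurfaceGroup (n + 3))⁆ ^ (if x.1 = ((0 : Fin (n + 3)), false).1 ∧ x.2 = false ∧ ((0 : Fin (n + 3)), false).2 = true then (1 : ℤ) else if x.1 = ((0 : Fin (n + 3)), false).1 ∧ x.2 = true ∧ ((0 : Fin (n + 3)), false).2 = false then (-1 : ℤ) else 0) * ⁅(PresentedGroup.of ((0 : Fin (n + 3)), true) : SurfaceGroup (n + 3)), (PresentedGroup.of ((0 : Fin (n + 3)), false) : SurfaceGroup (n + 3))⁆ ^ (if x.1 = ((1 : Fin (n + 3)), true).1 ∧ x.2 = false ∧ ((1 : Fin (n + 3)), true).2 = true then (1 : ℤ) else if x.1 = ((1 : Fin (n + 3)), true).1 ∧ x.2 = true ∧ ((1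 : Fin (n + 3)), true).2 = false then (-1 : ℤ) else 0))⁻¹ ∈ (⊤ : Subgroup (SurfaceGroup (n + 3))).lowerCentralSeries 2 := by
  have h10 := fin_one_ne_zero n
  have h01 : (0 : Fin (n + 3)) ≠ 1 := fun h => h10 h.symm
  obtain ⟨ψ, hψ, -⟩ := exists_bpAut n
  have hof : ∀ x : Fin (n + 3) × Bool, ψ (PresentedGroup.of x) = PresentedGroup.mk _ (
      (fun x : Fin (n + 3) × Bool =>
      if x.1 = 0 then ⁅genA (0 : Fin (n + 3)), genB 0⁆ * (genB 1)⁻¹ * FreeGroup.of x * genB 1 * (⁅genA (0 : Fin (n + 3)), genB 0⁆)⁻¹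
      else if x = (1, false) then ⁅genA (0 : Fin (n + 3)), genB 0⁆ * (genB 1)⁻¹ * (⁅genA (0 : Fin (n + 3)), genB 0⁆)⁻¹ * genB 1 * genA 1 * (⁅genA (0 : Fin (n + 3)), genB 0⁆)⁻¹
      else if x = (1, true) then ⁅genA (0 : Fin (n + 3)), genB 0⁆ * genB 1 * (⁅genA (0 : Fin (n + 3)), genB 0⁆)⁻¹
      else FreeGroup.of x) x) := fun x => by
    rw [PresentedGroup.of, hψ, FreeGroup.lift_apply_of]
  -- values on the letters (exact identities in `S`)
  have ea0 : ψ (PresentedGroup.of (0, false) : SurfaceGroup (n + 3)) * (PresentedGroup.of (0, false) : SurfaceGroup (n + 3))⁻¹ =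
      ⁅⁅(PresentedGroup.of (0, false) : SurfaceGroup (n + 3)), (PresentedGroup.of (0, true) : SurfaceGroup (n + 3))⁆, (PresentedGroup.of (1, true) : SurfaceGroup (n + 3))⁻¹ * (PresentedGroup.of (0, false) : SurfaceGroup (n + 3)) * (PresentedGroup.of (1, true) : SurfaceGroup (n + 3))⁆ * ⁅(PresentedGroup.of (1, true) : SurfaceGroup (n + 3))⁻¹, (PresentedGroup.of (0, false) : SurfaceGroup (n + 3))⁆ := by
    rw [hof]; simp only [commutatorElement_def, map_mul, map_inv, FreeGroup.lift_apply_of, genA, genB, if_true, if_false, h10, Prod.mk.injEq, and_true, and_false, Bool.false_eq_true, Bool.true_eq_false, true_and, false_and, PresentedGroup.of]; group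
  have eb0 : ψ (PresentedGroup.of (0, true) : SurfaceGroup (n + 3)) * (PresentedGroup.of (0, true) : SurfaceGroup (n + 3))⁻¹ =
      ⁅⁅(PresentedGroup.of (0, false) : SurfaceGroup (n + 3)), (PresentedGroup.of (0, true) : SurfaceGroup (n + 3))⁆, (PresentedGroup.of (1, true) : SurfaceGroup (n + 3))⁻¹ * (PresentedGroup.of (0, true) : SurfaceGroup (n + 3)) * (PresentedGroup.of (1, true) : SurfaceGroup (n + 3))⁆ * ⁅(PresentedGroup.of (1, true) : SurfaceGroup (n + 3))⁻¹, (PresentedGroup.of (0, true) : SurfaceGroup (n + 3))⁆ := by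
    rw [hof]; simp only [commutatorElement_def, map_mul, map_inv, FreeGroup.lift_apply_of, genA, genB, if_true, if_false, h10, Prod.mk.injEq, and_true, and_false, Bool.false_eq_true, Bool.true_eq_false, true_and, false_and, PresentedGroup.of]; group
  have ea1 : ψ (PresentedGroup.of (1, false) : SurfaceGroup (n + 3)) * (PresentedGroup.of (1, false) : SurfaceGroup (n + 3))⁻¹ =
      ⁅⁅(PresentedGroup.of (0, false) : SurfaceGroup (n + 3)), (PresentedGroup.of (0, true) : SurfaceGroup (n + 3))⁆, (PresentedGroup.of (1, true) : SurfaceGroup (n + 3))⁻¹⁆ * ⁅(PresentedGroup.of (1, false) : SurfaceGroup (n + 3)), (⁅(PresentedGroup.of (0, false) : SurfaceGroup (n + 3)), (PresentedGroup.of (0, true) : SurfaceGroup (n + 3))⁆)⁻¹⁆ * (⁅(PresentedGroup.of (0, false) : SurfaceGroup (n + 3)), (PresentedGroup.of (0, true) : SurfaceGroup (n + 3))⁆)⁻¹ := by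
    rw [hof]; simp only [commutatorElement_def, map_mul, map_inv, FreeGroup.lift_apply_of, genA, genB, if_true, if_false, h10, Prod.mk.injEq, and_true, and_false, Bool.false_eq_true, Bool.true_eq_false, true_and, false_and, PresentedGroup.of]; group
  have eb1 : ψ (PresentedGroup.of (1, true) : SurfaceGroup (n + 3)) * (PresentedGroup.of (1, true) : SurfaceGroup (n + 3))⁻¹ = ⁅⁅(PresentedGroup.of (0, false) : SurfaceGroup (n + 3)), (PresentedGroup.of (0, true) : SurfaceGroup (n + 3))⁆, (PresentedGroup.of (1, true) : SurfaceGroup (n + 3))⁆ := by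
    rw [hof]; simp only [commutatorElement_def, map_mul, map_inv, FreeGroup.lift_apply_of, genA, genB, if_true, if_false, h10, Prod.mk.injEq, and_true, and_false, Bool.false_eq_true, Bool.true_eq_false, true_and, false_and, PresentedGroup.of]
  have ene : ∀ (j : Fin (n + 3)) (ε : Bool), j ≠ 0 → j ≠ 1 →
      ψ (PresentedGroup.of (j, ε)) * (PresentedGroup.of (j, ε) : SurfaceGroup (n + 3))⁻¹ = 1 := fun j ε hj0 hj1 => by
    rw [hof]; simp [hj0, hj1, PresentedGroup.of]
  -- IA: `ψ` induces the identity on the abelianisation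
  have hIA : (∀ s : SurfaceGroup (n + 3), ψ s * s⁻¹ ∈ (⊤ : Subgroup (SurfaceGroup (n + 3))).lowerCentralSeries 1) := by
    have hhom : (Abelianization.of).comp ψ.toMonoidHom =
        (Abelianization.of : SurfaceGroup (n + 3) →* Abelianization (SurfaceGroup (n + 3))) := by
      refine PresentedGroup.ext fun x => ?_
      rw [MonoidHom.comp_apply, MulEquiv.coe_toMonoidHom, hof]
      apply Additive.ofMul.injective
      obtain ⟨j, ε⟩ := x
      by_cases h0 : j = 0
      · subst h0
        cases ε <;> simp only [commutatorElement_def, map_mul, map_inv, FreeGroup.lift_apply_of, genA, genB, if_true, if_false, h10, Prod.mk.injEq, and_true, and_false, Bool.false_eq_true, Bool.true_eq_false, true_and, false_and, PresentedGroup.of, ofMul_mul, ofMul_inv] <;> abel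
      by_cases h1 : j = 1
      · subst h1
        cases ε <;> simp only [commutatorElement_def, map_mul, map_inv, FreeGroup.lift_apply_of, genA, genB, if_true, if_false, h10, Prod.mk.injEq, and_true, and_false, Bool.false_eq_true, Bool.true_eq_false, true_and, false_and, PresentedGroup.of, ofMul_mul, ofMul_inv] <;> abel
      · simp [h0, h1, PresentedGroup.of]
    intro s
    have hs := DFunLike.congr_fun hhom s
    simp only [MonoidHom.comp_apply, MulEquiv.coe_toMonoidHom] at hs
    rw [Subgroup.top_lowerCentralSeries_one, ← Abelianization.ker_of, MonoidHom.mem_ker, map_mul,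
      map_inv, hs, mul_inv_cancel]
  have hC : ∀ z : SurfaceGroup (n + 3) ⧸ (⊤ : Subgroup (SurfaceGroup (n + 3))).lowerCentralSeries 2, ⁅((⁅(PresentedGroup.of (0, false) : SurfaceGroup (n + 3)), (PresentedGroup.of (0, true) : SurfaceGroup (n + 3))⁆ : SurfaceGroup (n + 3)) : SurfaceGroup (n + 3) ⧸ (⊤ : Subgroup (SurfaceGroup (n + 3))).lowerCentralSeries 2), z⁆ = 1 := fun z => by
    rw [quot_commutatorElement]; exact quot_class_two _ _ _
  refine ⟨ψ, hIA, fun x => ?_⟩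
  rw [mul_inv_mem_iff_quot, quot_triple]
  obtain ⟨j, ε⟩ := x
  by_cases hj0 : j = 0
  · subst hj0
    cases ε
    · rw [ea0, QuotientGroup.mk_mul, quot_commutatorElement, hC, one_mul, quot_commutatorElement,
        QuotientGroup.mk_inv, c2_inv_left quot_class_two, commutatorElement_inv]
      simp only [h01, and_true, and_false, true_and, false_and, if_true, if_false, Bool.false_eq_true, Bool.true_eq_false, eq_self_iff_true, ne_eq, not_false_eq_true, not_true_eq_false, zpow_zero, zpow_one, zpow_neg, mul_one, one_mul, inv_one, mul_inv_rev, inv_inv]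
    · rw [eb0, QuotientGroup.mk_mul, quot_commutatorElement, hC, one_mul, quot_commutatorElement,
        QuotientGroup.mk_inv, c2_inv_left quot_class_two]
      simp only [h01, and_true, and_false, true_and, false_and, if_true, if_false, Bool.false_eq_true, Bool.true_eq_false, eq_self_iff_true, ne_eq, not_false_eq_true, not_true_eq_false, zpow_zero, zpow_one, zpow_neg, mul_one, one_mul, inv_one, mul_inv_rev, inv_inv]
  by_cases hj1 : j = 1
  · subst hj1
    cases ε
    · rw [ea1, QuotientGroup.mk_mul, QuotientGroup.mk_mul, quot_commutatorElement, hC, one_mul,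
        quot_commutatorElement, QuotientGroup.mk_inv, c2_inv_right quot_class_two, commutatorElement_inv,
        hC, one_mul, quot_commutatorElement, commutatorElement_inv]
      simp only [h10, and_true, and_false, true_and, false_and, if_true, if_false, Bool.false_eq_true, Bool.true_eq_false, eq_self_iff_true, ne_eq, not_false_eq_true, not_true_eq_false, zpow_zero, zpow_one, zpow_neg, mul_one, one_mul, inv_one, mul_inv_rev, inv_inv]
    · rw [eb1, quot_commutatorElement, hC]
      simp only [h10, and_true, and_false, true_and, false_and, if_true, if_false, Bool.false_eq_true, Bool.true_eq_false, eq_self_iff_true, ne_eq, not_false_eq_true, not_true_eq_false, zpow_zero, zpow_one, zpow_neg, mul_one, one_mul, inv_one, mul_inv_rev, inv_inv]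
  · rw [ene j ε hj0 hj1, QuotientGroup.mk_one]
    simp only [hj0, hj1, and_true, and_false, true_and, false_and, if_true, if_false, Bool.false_eq_true, Bool.true_eq_false, eq_self_iff_true, ne_eq, not_false_eq_true, not_true_eq_false, zpow_zero, zpow_one, zpow_neg, mul_one, one_mul, inv_one, mul_inv_rev, inv_inv]

end BoundingPair

/-! ## A handle-mixing automorphism and a type II realiser -/

section Mixing

variable {n : ℕ}

/-- **A handle-mixing automorphism `μ` of the presented `S_{n+3}`**: the substitution
`a₀ ↦ a₀ a₁`, `b₀ ↦ a₁⁻¹ b₀ a₁`, `a₁ ↦ a₁⁻¹ b₀ a₁ b₁⁻¹`, `b₁ ↦ b₁ b₀⁻¹ a₁` (other letters fixed)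
satisfies `μ(c₀) μ(c₁) = c₀ c₁` in the free group (found by computer search), with inverse
`a₀ ↦ a₀ b₀⁻¹ b₁⁻¹ a₁⁻¹ b₀`, `b₀ ↦ b₀⁻¹ a₁ b₁ b₀ b₁⁻¹ a₁⁻¹ b₀`, `a₁ ↦ b₀⁻¹ a₁ b₁ b₀`, `b₁ ↦ a₁⁻¹ b₀`;
on homology `a₀ ↦ a₀ + a₁`, `b₀ ↦ b₀`, `a₁ ↦ b₀ - b₁`, `b₁ ↦ a₁ + b₁ - b₀` (it mixes the handles
`0` and `1`, which no letter permutation does). [folklore] -/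
theorem exists_mixAut (n : ℕ) : ∃ μ : SurfaceGroup (n + 3) ≃* SurfaceGroup (n + 3),
    (∀ w, μ (PresentedGroup.mk _ w) = PresentedGroup.mk _ (FreeGroup.lift
      (fun x : Fin (n + 3) × Bool =>
      if x = (0, false) then genA 0 * genA 1
      else if x = (0, true) then (genA 1)⁻¹ * genB 0 * genA 1
      else if x = (1, false) then (genA 1)⁻¹ * genB 0 * genA 1 * (genB 1)⁻¹
      else if x = (1, true) then genB 1 * (genB 0)⁻¹ * genA 1
      else FreeGroup.of x) w)) ∧
    (∀ w, μ.symm (PresentedGroup.mk _ w) = PresentedGroup.mk _ (FreeGroup.lift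
      (fun x : Fin (n + 3) × Bool =>
      if x = (0, false) then genA 0 * (genB 0)⁻¹ * (genB 1)⁻¹ * (genA 1)⁻¹ * genB 0
      else if x = (0, true) then (genB 0)⁻¹ * genA 1 * genB 1 * genB 0 * (genB 1)⁻¹ * (genA 1)⁻¹ * genB 0
      else if x = (1, false) then (genB 0)⁻¹ * genA 1 * genB 1 * genB 0
      else if x = (1, true) then (genA 1)⁻¹ * genB 0
      else FreeGroup.of x) w)) := by
  have h10 := fin_one_ne_zero n
  have h01 : (0 : Fin (n + 3)) ≠ 1 := fun h => h10 h.symm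
  refine exists_aut_of_subst _ _
    (mk_surfaceRelator_of_eq (lift_surfaceRelator_of_block _ (by simp only [commutatorElement_def, map_mul, map_inv, FreeGroup.lift_apply_of, genA, genB, if_true, if_false, h10, h01, Prod.mk.injEq, and_true, and_false, true_and, false_and, Bool.false_eq_true, Bool.true_eq_false]; group)
      (fun j ε h0 h1 => by simp [h0, h1])))
    (mk_surfaceRelator_of_eq (lift_surfaceRelator_of_block _ (by simp only [commutatorElement_def, map_mul, map_inv, FreeGroup.lift_apply_of, genA, genB, if_true, if_false, h10, h01, Prod.mk.injEq, and_true, and_false, true_and, false_and, Bool.false_eq_true, Bool.true_eq_false]; group)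
      (fun j ε h0 h1 => by simp [h0, h1])))
    (fun x => ?_) (fun x => ?_) <;>
  · obtain ⟨j, ε⟩ := x
    by_cases h0 : j = 0
    · subst h0
      cases ε <;> simp only [commutatorElement_def, map_mul, map_inv, FreeGroup.lift_apply_of, genA, genB, if_true, if_false, h10, h01, Prod.mk.injEq, and_true, and_false, true_and, false_and, Bool.false_eq_true, Bool.true_eq_false, PresentedGroup.of] <;> group
    by_cases h1 : j = 1
    · subst h1
      cases ε <;> simp only [commutatorElement_def, map_mul, map_inv, FreeGroup.lift_apply_of, genA, genB, if_true, if_false, h10, h01, Prod.mk.injEq, and_true, and_false, true_and, false_and, Bool.false_eq_true, Bool.true_eq_false, PresentedGroup.of] <;> group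
    · simp [h0, h1, PresentedGroup.of]

/-- **Mixing: a type II realiser from a type I realiser.** If `ψ` realises `(b₀, a₀, b_k)`
(`k ∉ {0, 1}`), then `(μ ψ μ⁻¹) ψ⁻¹` realises `(b₀, a₁, b_k)`: on homology `μ` fixes `b₀, b_k` and
sends `a₀ ↦ a₀ + a₁`, so `τ₁(μ ψ μ⁻¹) = Λ³μ (b₀ ∧ a₀ ∧ b_k) = b₀ ∧ a₀ ∧ b_k + b₀ ∧ a₁ ∧ b_k`.
[cite: Johnson1980AbelianQuotient, §5] -/
theorem realise_mix (k : Fin (n + 3)) (hk0 : k ≠ 0) (hk1 : k ≠ 1) :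
    (∃ ψ : SurfaceGroup (n + 3) ≃* SurfaceGroup (n + 3), (∀ s : SurfaceGroup (n + 3), ψ s * s⁻¹ ∈ (⊤ : Subgroup (SurfaceGroup (n + 3))).lowerCentralSeries 1) ∧ ∀ x : Fin (n + 3) × Bool, ψ (PresentedGroup.of x : SurfaceGroup (n + 3)) * (PresentedGroup.of x : SurfaceGroup (n + 3))⁻¹ * (⁅(PresentedGroup.of ((0 : Fin (n + 3)), false) : SurfaceGroup (n + 3)), (PresentedGroup.of (k, true) : SurfaceGroup (n + 3))⁆ ^ (if x.1 = ((0 : Fin (n + 3)), true).1 ∧ x.2 = false ∧ ((0 : Fin (n + 3)), true).2 = true then (1 : ℤ) else if x.1 = ((0 : Fin (n + 3)), true).1 ∧ x.2 = true ∧ ((0 : Fin (n + 3)), true).2 = false then (-1 : ℤ) else 0) * ⁅(PresentedGroup.of (k, true) : SurfaceGroup (n + 3)), (PresentedGroup.of ((0 : Fin (n + 3)), true) : SurfaceGroup (n + 3))⁆ ^ (if x.1 = ((0 : Fin (n + 3)), false).1 ∧ x.2 = false ∧ ((0 : Fin (n + 3)), false).2 = true then (1 : ℤ) else if x.1 = ((0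 : Fin (n + 3)), false).1 ∧ x.2 = true ∧ ((0 : Fin (n + 3)), false).2 = false then (-1 : ℤ) else 0) * ⁅(PresentedGroup.of ((0 : Fin (n + 3)), true) : SurfaceGroup (n + 3)), (PresentedGroup.of ((0 : Fin (n + 3)), false) : SurfaceGroup (n + 3))⁆ ^ (if x.1 = (k, true).1 ∧ x.2 = false ∧ (k, true).2 = true then (1 : ℤ) else if x.1 = (k, true).1 ∧ x.2 = true ∧ (k, true).2 = false then (-1 : ℤ) else 0))⁻¹ ∈ (⊤ : Subgroup (SurfaceGroup (n + 3))).lowerCentralSeries 2) →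
    ∃ ψ : SurfaceGroup (n + 3) ≃* SurfaceGroup (n + 3), (∀ s : SurfaceGroup (n + 3), ψ s * s⁻¹ ∈ (⊤ : Subgroup (SurfaceGroup (n + 3))).lowerCentralSeries 1) ∧ ∀ x : Fin (n + 3) × Bool, ψ (PresentedGroup.of x : SurfaceGroup (n + 3)) * (PresentedGroup.of x : SurfaceGroup (n + 3))⁻¹ * (⁅(PresentedGroup.of ((1 : Fin (n + 3)), false) : SurfaceGroup (n + 3)), (PresentedGroup.of (k, true) : SurfaceGroup (n + 3))⁆ ^ (if x.1 = ((0 : Fin (n + 3)), true).1 ∧ x.2 = false ∧ ((0 : Fin (n + 3)), true).2 = true then (1 : ℤ) else if x.1 = ((0 : Fin (n + 3)), true).1 ∧ x.2 = true ∧ ((0 : Fin (n + 3)), true).2 = false then (-1 : ℤ) else 0) * ⁅(PresentedGroup.of (k, true) : SurfaceGroup (n + 3)), (PresentedGroup.of ((0 : Fin (n + 3)), true) : SurfaceGroup (n + 3))⁆ ^ (if x.1 = ((1 : Fin (n + 3)), false).1 ∧ x.2 = false ∧ ((1 : Fin (n + 3)), false).2 = true then (1 : ℤ) else if x.1 = ((1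 : Fin (n + 3)), false).1 ∧ x.2 = true ∧ ((1 : Fin (n + 3)), false).2 = false then (-1 : ℤ) else 0) * ⁅(PresentedGroup.of ((0 : Fin (n + 3)), true) : SurfaceGroup (n + 3)), (PresentedGroup.of ((1 : Fin (n + 3)), false) : SurfaceGroup (n + 3))⁆ ^ (if x.1 = (k, true).1 ∧ x.2 = false ∧ (k, true).2 = true then (1 : ℤ) else if x.1 = (k, true).1 ∧ x.2 = true ∧ (k, true).2 = false then (-1 : ℤ) else 0))⁻¹ ∈ (⊤ : Subgroup (SurfaceGroup (n + 3))).lowerCentralSeries 2 := by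
  rintro ⟨ψ, hψ, hτ⟩
  have h10 := fin_one_ne_zero n
  have h01 : (0 : Fin (n + 3)) ≠ 1 := fun h => h10 h.symm
  have h0k : (0 : Fin (n + 3)) ≠ k := fun h => hk0 h.symm
  have h1k : (1 : Fin (n + 3)) ≠ k := fun h => hk1 h.symm
  obtain ⟨μ, hμ, hμ'⟩ := exists_mixAut n
  -- the letters under `μ` and `μ⁻¹`
  have mA0 : μ (PresentedGroup.of (0, false) : SurfaceGroup (n + 3)) = (PresentedGroup.of (0, false) : SurfaceGroup (n + 3)) * (PresentedGroup.of (1, false) : SurfaceGroup (n + 3)) := by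
    rw [PresentedGroup.of, hμ, FreeGroup.lift_apply_of]; simp only [commutatorElement_def, map_mul, map_inv, FreeGroup.lift_apply_of, genA, genB, if_true, if_false, h10, h01, Prod.mk.injEq, and_true, and_false, true_and, false_and, Bool.false_eq_true, Bool.true_eq_false, PresentedGroup.of]
  have mB0 : μ (PresentedGroup.of (0, true) : SurfaceGroup (n + 3)) = (PresentedGroup.of (1, false) : SurfaceGroup (n + 3))⁻¹ * (PresentedGroup.of (0, true) : SurfaceGroup (n + 3)) * (PresentedGroup.of (1, false) : SurfaceGroup (n + 3)) := by
    rw [PresentedGroup.of, hμ, FreeGroup.lift_apply_of]; simp only [commutatorElement_def, map_mul, map_inv, FreeGroup.lift_apply_of, genA, genB, if_true, if_false, h10, h01, Prod.mk.injEq, and_true, and_false, true_and, false_and, Bool.false_eq_true, Bool.true_eq_false, PresentedGroup.of]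
  have mA1 : μ (PresentedGroup.of (1, false) : SurfaceGroup (n + 3)) = (PresentedGroup.of (1, false) : SurfaceGroup (n + 3))⁻¹ * (PresentedGroup.of (0, true) : SurfaceGroup (n + 3)) * (PresentedGroup.of (1, false) : SurfaceGroup (n + 3)) * (PresentedGroup.of (1, true) : SurfaceGroup (n + 3))⁻¹ := by
    rw [PresentedGroup.of, hμ, FreeGroup.lift_apply_of]; simp only [commutatorElement_def, map_mul, map_inv, FreeGroup.lift_apply_of, genA, genB, if_true, if_false, h10, h01, Prod.mk.injEq, and_true, and_false, true_and, false_and, Bool.false_eq_true, Bool.true_eq_false, PresentedGroup.of]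
  have mB1 : μ (PresentedGroup.of (1, true) : SurfaceGroup (n + 3)) = (PresentedGroup.of (1, true) : SurfaceGroup (n + 3)) * (PresentedGroup.of (0, true) : SurfaceGroup (n + 3))⁻¹ * (PresentedGroup.of (1, false) : SurfaceGroup (n + 3)) := by
    rw [PresentedGroup.of, hμ, FreeGroup.lift_apply_of]; simp only [commutatorElement_def, map_mul, map_inv, FreeGroup.lift_apply_of, genA, genB, if_true, if_false, h10, h01, Prod.mk.injEq, and_true, and_false, true_and, false_and, Bool.false_eq_true, Bool.true_eq_false, PresentedGroup.of]
  have mne : ∀ (j : Fin (n + 3)) (ε : Bool), j ≠ 0 → j ≠ 1 →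
      μ (PresentedGroup.of (j, ε)) = (PresentedGroup.of (j, ε) : SurfaceGroup (n + 3)) := fun j ε hj0 hj1 => by
    rw [PresentedGroup.of, hμ, FreeGroup.lift_apply_of]; simp [hj0, hj1]
  have mAk : μ (PresentedGroup.of (k, false) : SurfaceGroup (n + 3)) = (PresentedGroup.of (k, false) : SurfaceGroup (n + 3)) := mne k false hk0 hk1
  have mBk : μ (PresentedGroup.of (k, true) : SurfaceGroup (n + 3)) = (PresentedGroup.of (k, true) : SurfaceGroup (n + 3)) := mne k true hk0 hk1
  have sA0 : μ.symm (PresentedGroup.of (0, false) : SurfaceGroup (n + 3)) = (PresentedGroup.of (0, false) : SurfaceGroup (n + 3)) * (PresentedGroup.of (0, true) : SurfaceGroup (n + 3))⁻¹ * (PresentedGroup.of (1, true) : SurfaceGroup (n + 3))⁻¹ * (PresentedGroup.of (1, false) : SurfaceGroup (n + 3))⁻¹ * (PresentedGroup.of (0, true) : SurfaceGroup (n + 3)) := by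
    rw [PresentedGroup.of, hμ', FreeGroup.lift_apply_of]; simp only [commutatorElement_def, map_mul, map_inv, FreeGroup.lift_apply_of, genA, genB, if_true, if_false, h10, h01, Prod.mk.injEq, and_true, and_false, true_and, false_and, Bool.false_eq_true, Bool.true_eq_false, PresentedGroup.of]
  have sB0 : μ.symm (PresentedGroup.of (0, true) : SurfaceGroup (n + 3)) = (PresentedGroup.of (0, true) : SurfaceGroup (n + 3))⁻¹ * (PresentedGroup.of (1, false) : SurfaceGroup (n + 3)) * (PresentedGroup.of (1, true) : SurfaceGroup (n + 3)) * (PresentedGroup.of (0, true) : SurfaceGroup (n + 3)) * (PresentedGroup.of (1, true) : SurfaceGroup (n + 3))⁻¹ * (PresentedGroup.of (1, false) : SurfaceGroup (n + 3))⁻¹ * (PresentedGroup.of (0, true) : SurfaceGroup (n + 3)) := by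
    rw [PresentedGroup.of, hμ', FreeGroup.lift_apply_of]; simp only [commutatorElement_def, map_mul, map_inv, FreeGroup.lift_apply_of, genA, genB, if_true, if_false, h10, h01, Prod.mk.injEq, and_true, and_false, true_and, false_and, Bool.false_eq_true, Bool.true_eq_false, PresentedGroup.of]
  have sA1 : μ.symm (PresentedGroup.of (1, false) : SurfaceGroup (n + 3)) = (PresentedGroup.of (0, true) : SurfaceGroup (n + 3))⁻¹ * (PresentedGroup.of (1, false) : SurfaceGroup (n + 3)) * (PresentedGroup.of (1, true) : SurfaceGroup (n + 3)) * (PresentedGroup.of (0, true) : SurfaceGroup (n + 3)) := by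
    rw [PresentedGroup.of, hμ', FreeGroup.lift_apply_of]; simp only [commutatorElement_def, map_mul, map_inv, FreeGroup.lift_apply_of, genA, genB, if_true, if_false, h10, h01, Prod.mk.injEq, and_true, and_false, true_and, false_and, Bool.false_eq_true, Bool.true_eq_false, PresentedGroup.of]
  have sB1 : μ.symm (PresentedGroup.of (1, true) : SurfaceGroup (n + 3)) = (PresentedGroup.of (1, false) : SurfaceGroup (n + 3))⁻¹ * (PresentedGroup.of (0, true) : SurfaceGroup (n + 3)) := by
    rw [PresentedGroup.of, hμ', FreeGroup.lift_apply_of]; simp only [commutatorElement_def, map_mul, map_inv, FreeGroup.lift_apply_of, genA, genB, if_true, if_false, h10, h01, Prod.mk.injEq, and_true, and_false, true_and, false_and, Bool.false_eq_true, Bool.true_eq_false, PresentedGroup.of]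
  have sne : ∀ (j : Fin (n + 3)) (ε : Bool), j ≠ 0 → j ≠ 1 →
      μ.symm (PresentedGroup.of (j, ε)) = (PresentedGroup.of (j, ε) : SurfaceGroup (n + 3)) := fun j ε hj0 hj1 => by
    rw [PresentedGroup.of, hμ', FreeGroup.lift_apply_of]; simp [hj0, hj1]
  -- the Johnson map of `ψ` on the letters, modulo `γ₃`
  have hτq : ∀ y : Fin (n + 3) × Bool, ((ψ (PresentedGroup.of y : SurfaceGroup (n + 3)) * (PresentedGroup.of y : SurfaceGroup (n + 3))⁻¹ : SurfaceGroup (n + 3)) : SurfaceGroup (n + 3) ⧸ (⊤ : Subgroup (SurfaceGroup (n + 3))).lowerCentralSeries 2) =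
      ((⁅(PresentedGroup.of ((0 : Fin (n + 3)), false) : SurfaceGroup (n + 3)), (PresentedGroup.of (k, true) : SurfaceGroup (n + 3))⁆ ^ (if y.1 = ((0 : Fin (n + 3)), true).1 ∧ y.2 = false ∧ ((0 : Fin (n + 3)), true).2 = true then (1 : ℤ) else if y.1 = ((0 : Fin (n + 3)), true).1 ∧ y.2 = true ∧ ((0 : Fin (n + 3)), true).2 = false then (-1 : ℤ) else 0) * ⁅(PresentedGroup.of (k, true) : SurfaceGroup (n + 3)), (PresentedGroup.of ((0 : Fin (n + 3)), true) : SurfaceGroup (n + 3))⁆ ^ (if y.1 = ((0 : Fin (n + 3)), false).1 ∧ y.2 = false ∧ ((0 : Fin (n + 3)), false).2 = true then (1 : ℤ) else if y.1 = ((0 : Fin (n + 3)), false).1 ∧ y.2 = true ∧ ((0 : Fin (n + 3)), false).2 = false then (-1 : ℤ) else 0) * ⁅(PresentedGroup.of ((0 : Fin (n + 3)), true) : SurfaceGroup (n + 3)), (PresentedGroup.of ((0 : Fin (n + 3)), false) : SurfaceGroup (n + 3))⁆ ^ (if y.1 = (k, true).1 ∧ y.2 = false ∧ (k, true).2 = true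 then (1 : ℤ) else if y.1 = (k, true).1 ∧ y.2 = true ∧ (k, true).2 = false then (-1 : ℤ) else 0) : SurfaceGroup (n + 3)) : SurfaceGroup (n + 3) ⧸ (⊤ : Subgroup (SurfaceGroup (n + 3))).lowerCentralSeries 2) :=
    fun y => (mul_inv_mem_iff_quot _ _ _).1 (hτ y)
  have tA0 : ((ψ (PresentedGroup.of (0, false) : SurfaceGroup (n + 3)) * (PresentedGroup.of (0, false) : SurfaceGroup (n + 3))⁻¹ : SurfaceGroup (n + 3)) : SurfaceGroup (n + 3) ⧸ (⊤ : Subgroup (SurfaceGroup (n + 3))).lowerCentralSeries 2) = ⁅(((PresentedGroup.of (0, false) : SurfaceGroup (n + 3)) : SurfaceGroup (n + 3)) : SurfaceGroup (n + 3) ⧸ (⊤ : Subgroup (SurfaceGroup (n + 3))).lowerCentralSeries 2), (((PresentedGroup.of (k, true) : SurfaceGroup (n + 3)) : SurfaceGroup (n + 3)) : SurfaceGroup (n + 3) ⧸ (⊤ : Subgroup (SurfaceGroup (n + 3))).lowerCentralSeries 2)⁆ := by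
    rw [hτq, quot_triple]; simp only [h10, h01, hk0, hk1, h0k, h1k, and_true, and_false, true_and, false_and, if_true, if_false, Bool.false_eq_true, Bool.true_eq_false, eq_self_iff_true, ne_eq, not_false_eq_true, not_true_eq_false, zpow_zero, zpow_one, zpow_neg, mul_one, one_mul, inv_one, mul_inv_rev, inv_inv]
  have tB0 : ((ψ (PresentedGroup.of (0, true) : SurfaceGroup (n + 3)) * (PresentedGroup.of (0, true) : SurfaceGroup (n + 3))⁻¹ : SurfaceGroup (n + 3)) : SurfaceGroup (n + 3) ⧸ (⊤ : Subgroup (SurfaceGroup (n + 3))).lowerCentralSeries 2) = ⁅(((PresentedGroup.of (k, true) : SurfaceGroup (n + 3)) : SurfaceGroup (n + 3)) : SurfaceGroup (n + 3) ⧸ (⊤ : Subgroup (SurfaceGroup (n + 3))).lowerCentralSeries 2), (((PresentedGroup.of (0, true) : SurfaceGroup (n + 3)) : SurfaceGroup (n + 3)) : SurfaceGroup (n + 3) ⧸ (⊤ : Subgroup (SurfaceGroup (n + 3))).lowerCentralSeries 2)⁆⁻¹ := by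
    rw [hτq, quot_triple]; simp only [h10, h01, hk0, hk1, h0k, h1k, and_true, and_false, true_and, false_and, if_true, if_false, Bool.false_eq_true, Bool.true_eq_false, eq_self_iff_true, ne_eq, not_false_eq_true, not_true_eq_false, zpow_zero, zpow_one, zpow_neg, mul_one, one_mul, inv_one, mul_inv_rev, inv_inv]
  have tA1 : ((ψ (PresentedGroup.of (1, false) : SurfaceGroup (n + 3)) * (PresentedGroup.of (1, false) : SurfaceGroup (n + 3))⁻¹ : SurfaceGroup (n + 3)) : SurfaceGroup (n + 3) ⧸ (⊤ : Subgroup (SurfaceGroup (n + 3))).lowerCentralSeries 2) = 1 := by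
    rw [hτq, quot_triple]; simp only [h10, h01, hk0, hk1, h0k, h1k, and_true, and_false, true_and, false_and, if_true, if_false, Bool.false_eq_true, Bool.true_eq_false, eq_self_iff_true, ne_eq, not_false_eq_true, not_true_eq_false, zpow_zero, zpow_one, zpow_neg, mul_one, one_mul, inv_one, mul_inv_rev, inv_inv]
  have tB1 : ((ψ (PresentedGroup.of (1, true) : SurfaceGroup (n + 3)) * (PresentedGroup.of (1, true) : SurfaceGroup (n + 3))⁻¹ : SurfaceGroup (n + 3)) : SurfaceGroup (n + 3) ⧸ (⊤ : Subgroup (SurfaceGroup (n + 3))).lowerCentralSeries 2) = 1 := by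
    rw [hτq, quot_triple]; simp only [h10, h01, hk0, hk1, h0k, h1k, and_true, and_false, true_and, false_and, if_true, if_false, Bool.false_eq_true, Bool.true_eq_false, eq_self_iff_true, ne_eq, not_false_eq_true, not_true_eq_false, zpow_zero, zpow_one, zpow_neg, mul_one, one_mul, inv_one, mul_inv_rev, inv_inv]
  have tAk : ((ψ (PresentedGroup.of (k, false) : SurfaceGroup (n + 3)) * (PresentedGroup.of (k, false) : SurfaceGroup (n + 3))⁻¹ : SurfaceGroup (n + 3)) : SurfaceGroup (n + 3) ⧸ (⊤ : Subgroup (SurfaceGroup (n + 3))).lowerCentralSeries 2) = ⁅(((PresentedGroup.of (0, true) : SurfaceGroup (n + 3)) : SurfaceGroup (n + 3)) : SurfaceGroup (n + 3) ⧸ (⊤ : Subgroup (SurfaceGroup (n + 3))).lowerCentralSeries 2), (((PresentedGroup.of (0, false) : SurfaceGroup (n + 3)) : SurfaceGroup (n + 3)) : SurfaceGroup (n + 3) ⧸ (⊤ : Subgroup (SurfaceGroup (n + 3))).lowerCentralSeries 2)⁆ := by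
    rw [hτq, quot_triple]; simp only [h10, h01, hk0, hk1, h0k, h1k, and_true, and_false, true_and, false_and, if_true, if_false, Bool.false_eq_true, Bool.true_eq_false, eq_self_iff_true, ne_eq, not_false_eq_true, not_true_eq_false, zpow_zero, zpow_one, zpow_neg, mul_one, one_mul, inv_one, mul_inv_rev, inv_inv]
  have tBk : ((ψ (PresentedGroup.of (k, true) : SurfaceGroup (n + 3)) * (PresentedGroup.of (k, true) : SurfaceGroup (n + 3))⁻¹ : SurfaceGroup (n + 3)) : SurfaceGroup (n + 3) ⧸ (⊤ : Subgroup (SurfaceGroup (n + 3))).lowerCentralSeries 2) = 1 := by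
    rw [hτq, quot_triple]; simp only [h10, h01, hk0, hk1, h0k, h1k, and_true, and_false, true_and, false_and, if_true, if_false, Bool.false_eq_true, Bool.true_eq_false, eq_self_iff_true, ne_eq, not_false_eq_true, not_true_eq_false, zpow_zero, zpow_one, zpow_neg, mul_one, one_mul, inv_one, mul_inv_rev, inv_inv]
  -- `μ` descends to the quotient
  have hle : (⊤ : Subgroup (SurfaceGroup (n + 3))).lowerCentralSeries 2 ≤
      ((⊤ : Subgroup (SurfaceGroup (n + 3))).lowerCentralSeries 2).comap μ.toMonoidHom := fun g hg => equiv_mem_lcs μ hg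
  have hθ : ∀ g : SurfaceGroup (n + 3), ((μ g : SurfaceGroup (n + 3)) : SurfaceGroup (n + 3) ⧸ (⊤ : Subgroup (SurfaceGroup (n + 3))).lowerCentralSeries 2) =
      QuotientGroup.map _ _ μ.toMonoidHom hle (g : SurfaceGroup (n + 3) ⧸ (⊤ : Subgroup (SurfaceGroup (n + 3))).lowerCentralSeries 2) := fun g => by
    rw [QuotientGroup.map_mk, MulEquiv.coe_toMonoidHom]
  have hφ₁ : (∀ s : SurfaceGroup (n + 3), (μ.symm.trans (ψ.trans μ)) s * s⁻¹ ∈ (⊤ : Subgroup (SurfaceGroup (n + 3))).lowerCentralSeries 1) := ia_conj hψ μ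
  refine ⟨ψ.symm.trans (μ.symm.trans (ψ.trans μ)), ia_trans (ia_symm hψ) hφ₁, fun x => ?_⟩
  rw [mul_inv_mem_iff_quot, MulEquiv.trans_apply, ia_quot_trans (ia_symm hψ) hφ₁, ia_quot_symm hψ, hτq,
    conj_tau]
  obtain ⟨j, ε⟩ := x
  by_cases hj0 : j = 0
  · subst hj0
    cases ε
    · rw [hθ, sA0, quot_triple]
      simp only [ia_quot_mul hψ, ia_quot_inv hψ, tA0, tB0, tA1, tB1, tAk, tBk]
      simp only [h10, h01, hk0, hk1, h0k, h1k, and_true, and_false, true_and, false_and, if_true, if_false, Bool.false_eq_true, Bool.true_eq_false, eq_self_iff_true, ne_eq, not_false_eq_true, not_true_eq_false, zpow_zero, zpow_one, zpow_neg, mul_one, one_mul, inv_one, mul_inv_rev, inv_inv]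
      simp only [map_mul, map_inv, map_one, map_commutatorElement]
      simp only [QuotientGroup.map_mk, MulEquiv.coe_toMonoidHom]
      simp only [mA0, mB0, mA1, mB1, mAk, mBk]
      simp only [QuotientGroup.mk_mul, QuotientGroup.mk_inv, QuotientGroup.mk_one, quot_commutatorElement]
      simp only [c2_mul_left quot_class_two, c2_mul_right quot_class_two, c2_inv_left quot_class_two, c2_inv_right quot_class_two, commutatorElement_self, commutatorElement_one_left, commutatorElement_one_right]
      simp only [← commutatorElement_inv (((PresentedGroup.of (0, false) : SurfaceGroup (n + 3)) : SurfaceGroup (n + 3)) : SurfaceGroup (n + 3) ⧸ (⊤ : Subgroup (SurfaceGroup (n + 3))).lowerCentralSeries 2) (((PresentedGroup.of (0, true) : SurfaceGroup (n + 3)) : SurfaceGroup (n + 3)) : SurfaceGroup (n + 3) ⧸ (⊤ : Subgroup (SurfaceGroup (n + 3))).lowerCentralSeries 2), ← commutatorElement_inv (((PresentedGroup.of (0, false) : SurfaceGroup (n + 3)) : SurfaceGroup (n + 3)) : SurfaceGroup (n + 3) ⧸ (⊤ : Subgroup (SurfaceGroup (n + 3))).lowerCentralSeries 2) (((PresentedGroup.of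 (1, false) : SurfaceGroup (n + 3)) : SurfaceGroup (n + 3)) : SurfaceGroup (n + 3) ⧸ (⊤ : Subgroup (SurfaceGroup (n + 3))).lowerCentralSeries 2), ← commutatorElement_inv (((PresentedGroup.of (0, false) : SurfaceGroup (n + 3)) : SurfaceGroup (n + 3)) : SurfaceGroup (n + 3) ⧸ (⊤ : Subgroup (SurfaceGroup (n + 3))).lowerCentralSeries 2) (((PresentedGroup.of (1, true) : SurfaceGroup (n + 3)) : SurfaceGroup (n + 3)) : SurfaceGroup (n + 3) ⧸ (⊤ : Subgroup (SurfaceGroup (n + 3))).lowerCentralSeries 2), ← commutatorElement_inv (((PresentedGroup.of (0, false) : SurfaceGroup (n + 3)) : SurfaceGroup (n + 3)) : SurfaceGroup (n + 3) ⧸ (⊤ : Subgroup (SurfaceGroup (n + 3))).lowerCentralSeries 2) (((PresentedGroup.of (k, false) : SurfaceGroup (n + 3)) : SurfaceGroup (n + 3)) : SurfaceGroup (n + 3) ⧸ (⊤ : Subgroup (SurfaceGroup (n + 3))).lowerCentralSeries 2), ← commutatorElement_inv (((PresentedGroup.of (0, false) : SurfaceGroup (n + 3)) : SurfaceGroup (n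 + 3)) : SurfaceGroup (n + 3) ⧸ (⊤ : Subgroup (SurfaceGroup (n + 3))).lowerCentralSeries 2) (((PresentedGroup.of (k, true) : SurfaceGroup (n + 3)) : SurfaceGroup (n + 3)) : SurfaceGroup (n + 3) ⧸ (⊤ : Subgroup (SurfaceGroup (n + 3))).lowerCentralSeries 2), ← commutatorElement_inv (((PresentedGroup.of (0, true) : SurfaceGroup (n + 3)) : SurfaceGroup (n + 3)) : SurfaceGroup (n + 3) ⧸ (⊤ : Subgroup (SurfaceGroup (n + 3))).lowerCentralSeries 2) (((PresentedGroup.of (1, false) : SurfaceGroup (n + 3)) : SurfaceGroup (n + 3)) : SurfaceGroup (n + 3) ⧸ (⊤ : Subgroup (SurfaceGroup (n + 3))).lowerCentralSeries 2), ← commutatorElement_inv (((PresentedGroup.of (0, true) : SurfaceGroup (n + 3)) : SurfaceGroup (n + 3)) : SurfaceGroup (n + 3) ⧸ (⊤ : Subgroup (SurfaceGroup (n + 3))).lowerCentralSeries 2) (((PresentedGroup.of (1, true) : SurfaceGroup (n + 3)) : SurfaceGroup (n + 3)) : SurfaceGroup (n + 3) ⧸ (⊤ : Subgroup (SurfaceGroup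 (n + 3))).lowerCentralSeries 2), ← commutatorElement_inv (((PresentedGroup.of (0, true) : SurfaceGroup (n + 3)) : SurfaceGroup (n + 3)) : SurfaceGroup (n + 3) ⧸ (⊤ : Subgroup (SurfaceGroup (n + 3))).lowerCentralSeries 2) (((PresentedGroup.of (k, false) : SurfaceGroup (n + 3)) : SurfaceGroup (n + 3)) : SurfaceGroup (n + 3) ⧸ (⊤ : Subgroup (SurfaceGroup (n + 3))).lowerCentralSeries 2), ← commutatorElement_inv (((PresentedGroup.of (0, true) : SurfaceGroup (n + 3)) : SurfaceGroup (n + 3)) : SurfaceGroup (n + 3) ⧸ (⊤ : Subgroup (SurfaceGroup (n + 3))).lowerCentralSeries 2) (((PresentedGroup.of (k, true) : SurfaceGroup (n + 3)) : SurfaceGroup (n + 3)) : SurfaceGroup (n + 3) ⧸ (⊤ : Subgroup (SurfaceGroup (n + 3))).lowerCentralSeries 2), ← commutatorElement_inv (((PresentedGroup.of (1, false) : SurfaceGroup (n + 3)) : SurfaceGroup (n + 3)) : SurfaceGroup (n + 3) ⧸ (⊤ : Subgroup (SurfaceGroup (n + 3))).lowerCentralSeries 2) (((PresentedGroup.of (1,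 true) : SurfaceGroup (n + 3)) : SurfaceGroup (n + 3)) : SurfaceGroup (n + 3) ⧸ (⊤ : Subgroup (SurfaceGroup (n + 3))).lowerCentralSeries 2), ← commutatorElement_inv (((PresentedGroup.of (1, false) : SurfaceGroup (n + 3)) : SurfaceGroup (n + 3)) : SurfaceGroup (n + 3) ⧸ (⊤ : Subgroup (SurfaceGroup (n + 3))).lowerCentralSeries 2) (((PresentedGroup.of (k, false) : SurfaceGroup (n + 3)) : SurfaceGroup (n + 3)) : SurfaceGroup (n + 3) ⧸ (⊤ : Subgroup (SurfaceGroup (n + 3))).lowerCentralSeries 2), ← commutatorElement_inv (((PresentedGroup.of (1, false) : SurfaceGroup (n + 3)) : SurfaceGroup (n + 3)) : SurfaceGroup (n + 3) ⧸ (⊤ : Subgroup (SurfaceGroup (n + 3))).lowerCentralSeries 2) (((PresentedGroup.of (k, true) : SurfaceGroup (n + 3)) : SurfaceGroup (n + 3)) : SurfaceGroup (n + 3) ⧸ (⊤ : Subgroup (SurfaceGroup (n + 3))).lowerCentralSeries 2), ← commutatorElement_inv (((PresentedGroup.of (1, true) : SurfaceGroup (n + 3)) : SurfaceGroup (n + 3))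 : SurfaceGroup (n + 3) ⧸ (⊤ : Subgroup (SurfaceGroup (n + 3))).lowerCentralSeries 2) (((PresentedGroup.of (k, false) : SurfaceGroup (n + 3)) : SurfaceGroup (n + 3)) : SurfaceGroup (n + 3) ⧸ (⊤ : Subgroup (SurfaceGroup (n + 3))).lowerCentralSeries 2), ← commutatorElement_inv (((PresentedGroup.of (1, true) : SurfaceGroup (n + 3)) : SurfaceGroup (n + 3)) : SurfaceGroup (n + 3) ⧸ (⊤ : Subgroup (SurfaceGroup (n + 3))).lowerCentralSeries 2) (((PresentedGroup.of (k, true) : SurfaceGroup (n + 3)) : SurfaceGroup (n + 3)) : SurfaceGroup (n + 3) ⧸ (⊤ : Subgroup (SurfaceGroup (n + 3))).lowerCentralSeries 2), ← commutatorElement_inv (((PresentedGroup.of (k, false) : SurfaceGroup (n + 3)) : SurfaceGroup (n + 3)) : SurfaceGroup (n + 3) ⧸ (⊤ : Subgroup (SurfaceGroup (n + 3))).lowerCentralSeries 2) (((PresentedGroup.of (k, true) : SurfaceGroup (n + 3)) : SurfaceGroup (n + 3)) : SurfaceGroup (n + 3) ⧸ (⊤ : Subgroup (SurfaceGroup (n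 + 3))).lowerCentralSeries 2), inv_inv, mul_inv_rev, inv_one, mul_one, one_mul]
      obtain ⟨f, hf⟩ : ∃ f : SurfaceGroup (n + 3) ⧸ (⊤ : Subgroup (SurfaceGroup (n + 3))).lowerCentralSeries 2 → SurfaceGroup (n + 3) ⧸ (⊤ : Subgroup (SurfaceGroup (n + 3))).lowerCentralSeries 2 →
          Subgroup.center (SurfaceGroup (n + 3) ⧸ (⊤ : Subgroup (SurfaceGroup (n + 3))).lowerCentralSeries 2), ∀ a b, ((f a b : Subgroup.center (SurfaceGroup (n + 3) ⧸ (⊤ : Subgroup (SurfaceGroup (n + 3))).lowerCentralSeries 2)) : SurfaceGroup (n + 3) ⧸ (⊤ : Subgroup (SurfaceGroup (n + 3))).lowerCentralSeries 2) = ⁅a, b⁆ :=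
        ⟨fun a b => ⟨⁅a, b⁆, c2_mem_center quot_class_two a b⟩, fun _ _ => rfl⟩
      simp only [← hf, ← Subgroup.coe_mul, ← Subgroup.coe_inv]
      try rw [← Subgroup.coe_one (Subgroup.center _)]
      rw [Subtype.coe_inj]
      open scoped IsMulCommutative in (apply Additive.ofMul.injective; simp only [ofMul_mul, ofMul_inv, ofMul_one]; abel)
    · rw [hθ, sB0, quot_triple]
      simp only [ia_quot_mul hψ, ia_quot_inv hψ, tA0, tB0, tA1, tB1, tAk, tBk]
      simp only [h10, h01, hk0, hk1, h0k, h1k, and_true, and_false, true_and, false_and, if_true, if_false, Bool.false_eq_true, Bool.true_eq_false, eq_self_iff_true, ne_eq, not_false_eq_true, not_true_eq_false, zpow_zero, zpow_one, zpow_neg, mul_one, one_mul, inv_one, mul_inv_rev, inv_inv]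
      simp only [map_mul, map_inv, map_one, map_commutatorElement]
      simp only [QuotientGroup.map_mk, MulEquiv.coe_toMonoidHom]
      simp only [mA0, mB0, mA1, mB1, mAk, mBk]
      simp only [QuotientGroup.mk_mul, QuotientGroup.mk_inv, QuotientGroup.mk_one, quot_commutatorElement]
      simp only [c2_mul_left quot_class_two, c2_mul_right quot_class_two, c2_inv_left quot_class_two, c2_inv_right quot_class_two, commutatorElement_self, commutatorElement_one_left, commutatorElement_one_right]
      simp only [← commutatorElement_inv (((PresentedGroup.of (0, false) : SurfaceGroup (n + 3)) : SurfaceGroup (n + 3)) : SurfaceGroup (n + 3) ⧸ (⊤ : Subgroup (SurfaceGroup (n + 3))).lowerCentralSeries 2) (((PresentedGroup.of (0, true) : SurfaceGroup (n + 3)) : SurfaceGroup (n + 3)) : SurfaceGroup (n + 3) ⧸ (⊤ : Subgroup (SurfaceGroup (n + 3))).lowerCentralSeries 2), ← commutatorElement_inv (((PresentedGroup.of (0, false) : SurfaceGroup (n + 3)) : SurfaceGroup (n + 3)) : SurfaceGroup (n + 3) ⧸ (⊤ : Subgroup (SurfaceGroup (n + 3))).lowerCentralSeries 2) (((PresentedGroup.of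 (1, false) : SurfaceGroup (n + 3)) : SurfaceGroup (n + 3)) : SurfaceGroup (n + 3) ⧸ (⊤ : Subgroup (SurfaceGroup (n + 3))).lowerCentralSeries 2), ← commutatorElement_inv (((PresentedGroup.of (0, false) : SurfaceGroup (n + 3)) : SurfaceGroup (n + 3)) : SurfaceGroup (n + 3) ⧸ (⊤ : Subgroup (SurfaceGroup (n + 3))).lowerCentralSeries 2) (((PresentedGroup.of (1, true) : SurfaceGroup (n + 3)) : SurfaceGroup (n + 3)) : SurfaceGroup (n + 3) ⧸ (⊤ : Subgroup (SurfaceGroup (n + 3))).lowerCentralSeries 2), ← commutatorElement_inv (((PresentedGroup.of (0, false) : SurfaceGroup (n + 3)) : SurfaceGroup (n + 3)) : SurfaceGroup (n + 3) ⧸ (⊤ : Subgroup (SurfaceGroup (n + 3))).lowerCentralSeries 2) (((PresentedGroup.of (k, false) : SurfaceGroup (n + 3)) : SurfaceGroup (n + 3)) : SurfaceGroup (n + 3) ⧸ (⊤ : Subgroup (SurfaceGroup (n + 3))).lowerCentralSeries 2), ← commutatorElement_inv (((PresentedGroup.of (0, false) : SurfaceGroup (n + 3)) : SurfaceGroup (n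 + 3)) : SurfaceGroup (n + 3) ⧸ (⊤ : Subgroup (SurfaceGroup (n + 3))).lowerCentralSeries 2) (((PresentedGroup.of (k, true) : SurfaceGroup (n + 3)) : SurfaceGroup (n + 3)) : SurfaceGroup (n + 3) ⧸ (⊤ : Subgroup (SurfaceGroup (n + 3))).lowerCentralSeries 2), ← commutatorElement_inv (((PresentedGroup.of (0, true) : SurfaceGroup (n + 3)) : SurfaceGroup (n + 3)) : SurfaceGroup (n + 3) ⧸ (⊤ : Subgroup (SurfaceGroup (n + 3))).lowerCentralSeries 2) (((PresentedGroup.of (1, false) : SurfaceGroup (n + 3)) : SurfaceGroup (n + 3)) : SurfaceGroup (n + 3) ⧸ (⊤ : Subgroup (SurfaceGroup (n + 3))).lowerCentralSeries 2), ← commutatorElement_inv (((PresentedGroup.of (0, true) : SurfaceGroup (n + 3)) : SurfaceGroup (n + 3)) : SurfaceGroup (n + 3) ⧸ (⊤ : Subgroup (SurfaceGroup (n + 3))).lowerCentralSeries 2) (((PresentedGroup.of (1, true) : SurfaceGroup (n + 3)) : SurfaceGroup (n + 3)) : SurfaceGroup (n + 3) ⧸ (⊤ : Subgroup (SurfaceGroup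 (n + 3))).lowerCentralSeries 2), ← commutatorElement_inv (((PresentedGroup.of (0, true) : SurfaceGroup (n + 3)) : SurfaceGroup (n + 3)) : SurfaceGroup (n + 3) ⧸ (⊤ : Subgroup (SurfaceGroup (n + 3))).lowerCentralSeries 2) (((PresentedGroup.of (k, false) : SurfaceGroup (n + 3)) : SurfaceGroup (n + 3)) : SurfaceGroup (n + 3) ⧸ (⊤ : Subgroup (SurfaceGroup (n + 3))).lowerCentralSeries 2), ← commutatorElement_inv (((PresentedGroup.of (0, true) : SurfaceGroup (n + 3)) : SurfaceGroup (n + 3)) : SurfaceGroup (n + 3) ⧸ (⊤ : Subgroup (SurfaceGroup (n + 3))).lowerCentralSeries 2) (((PresentedGroup.of (k, true) : SurfaceGroup (n + 3)) : SurfaceGroup (n + 3)) : SurfaceGroup (n + 3) ⧸ (⊤ : Subgroup (SurfaceGroup (n + 3))).lowerCentralSeries 2), ← commutatorElement_inv (((PresentedGroup.of (1, false) : SurfaceGroup (n + 3)) : SurfaceGroup (n + 3)) : SurfaceGroup (n + 3) ⧸ (⊤ : Subgroup (SurfaceGroup (n + 3))).lowerCentralSeries 2) (((PresentedGroup.of (1,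 true) : SurfaceGroup (n + 3)) : SurfaceGroup (n + 3)) : SurfaceGroup (n + 3) ⧸ (⊤ : Subgroup (SurfaceGroup (n + 3))).lowerCentralSeries 2), ← commutatorElement_inv (((PresentedGroup.of (1, false) : SurfaceGroup (n + 3)) : SurfaceGroup (n + 3)) : SurfaceGroup (n + 3) ⧸ (⊤ : Subgroup (SurfaceGroup (n + 3))).lowerCentralSeries 2) (((PresentedGroup.of (k, false) : SurfaceGroup (n + 3)) : SurfaceGroup (n + 3)) : SurfaceGroup (n + 3) ⧸ (⊤ : Subgroup (SurfaceGroup (n + 3))).lowerCentralSeries 2), ← commutatorElement_inv (((PresentedGroup.of (1, false) : SurfaceGroup (n + 3)) : SurfaceGroup (n + 3)) : SurfaceGroup (n + 3) ⧸ (⊤ : Subgroup (SurfaceGroup (n + 3))).lowerCentralSeries 2) (((PresentedGroup.of (k, true) : SurfaceGroup (n + 3)) : SurfaceGroup (n + 3)) : SurfaceGroup (n + 3) ⧸ (⊤ : Subgroup (SurfaceGroup (n + 3))).lowerCentralSeries 2), ← commutatorElement_inv (((PresentedGroup.of (1, true) : SurfaceGroup (n + 3)) : SurfaceGroup (n + 3))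 : SurfaceGroup (n + 3) ⧸ (⊤ : Subgroup (SurfaceGroup (n + 3))).lowerCentralSeries 2) (((PresentedGroup.of (k, false) : SurfaceGroup (n + 3)) : SurfaceGroup (n + 3)) : SurfaceGroup (n + 3) ⧸ (⊤ : Subgroup (SurfaceGroup (n + 3))).lowerCentralSeries 2), ← commutatorElement_inv (((PresentedGroup.of (1, true) : SurfaceGroup (n + 3)) : SurfaceGroup (n + 3)) : SurfaceGroup (n + 3) ⧸ (⊤ : Subgroup (SurfaceGroup (n + 3))).lowerCentralSeries 2) (((PresentedGroup.of (k, true) : SurfaceGroup (n + 3)) : SurfaceGroup (n + 3)) : SurfaceGroup (n + 3) ⧸ (⊤ : Subgroup (SurfaceGroup (n + 3))).lowerCentralSeries 2), ← commutatorElement_inv (((PresentedGroup.of (k, false) : SurfaceGroup (n + 3)) : SurfaceGroup (n + 3)) : SurfaceGroup (n + 3) ⧸ (⊤ : Subgroup (SurfaceGroup (n + 3))).lowerCentralSeries 2) (((PresentedGroup.of (k, true) : SurfaceGroup (n + 3)) : SurfaceGroup (n + 3)) : SurfaceGroup (n + 3) ⧸ (⊤ : Subgroup (SurfaceGroup (n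 + 3))).lowerCentralSeries 2), inv_inv, mul_inv_rev, inv_one, mul_one, one_mul]
      obtain ⟨f, hf⟩ : ∃ f : SurfaceGroup (n + 3) ⧸ (⊤ : Subgroup (SurfaceGroup (n + 3))).lowerCentralSeries 2 → SurfaceGroup (n + 3) ⧸ (⊤ : Subgroup (SurfaceGroup (n + 3))).lowerCentralSeries 2 →
          Subgroup.center (SurfaceGroup (n + 3) ⧸ (⊤ : Subgroup (SurfaceGroup (n + 3))).lowerCentralSeries 2), ∀ a b, ((f a b : Subgroup.center (SurfaceGroup (n + 3) ⧸ (⊤ : Subgroup (SurfaceGroup (n + 3))).lowerCentralSeries 2)) : SurfaceGroup (n + 3) ⧸ (⊤ : Subgroup (SurfaceGroup (n + 3))).lowerCentralSeries 2) = ⁅a, b⁆ :=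
        ⟨fun a b => ⟨⁅a, b⁆, c2_mem_center quot_class_two a b⟩, fun _ _ => rfl⟩
      simp only [← hf, ← Subgroup.coe_mul, ← Subgroup.coe_inv]
      try rw [← Subgroup.coe_one (Subgroup.center _)]
      rw [Subtype.coe_inj]
      open scoped IsMulCommutative in (apply Additive.ofMul.injective; simp only [ofMul_mul, ofMul_inv, ofMul_one]; abel)
  by_cases hj1 : j = 1
  · subst hj1
    cases ε
    · rw [hθ, sA1, quot_triple]
      simp only [ia_quot_mul hψ, ia_quot_inv hψ, tA0, tB0, tA1, tB1, tAk, tBk]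
      simp only [h10, h01, hk0, hk1, h0k, h1k, and_true, and_false, true_and, false_and, if_true, if_false, Bool.false_eq_true, Bool.true_eq_false, eq_self_iff_true, ne_eq, not_false_eq_true, not_true_eq_false, zpow_zero, zpow_one, zpow_neg, mul_one, one_mul, inv_one, mul_inv_rev, inv_inv]
      simp only [map_mul, map_inv, map_one, map_commutatorElement]
      simp only [QuotientGroup.map_mk, MulEquiv.coe_toMonoidHom]
      simp only [mA0, mB0, mA1, mB1, mAk, mBk]
      simp only [QuotientGroup.mk_mul, QuotientGroup.mk_inv, QuotientGroup.mk_one, quot_commutatorElement]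
      simp only [c2_mul_left quot_class_two, c2_mul_right quot_class_two, c2_inv_left quot_class_two, c2_inv_right quot_class_two, commutatorElement_self, commutatorElement_one_left, commutatorElement_one_right]
      simp only [← commutatorElement_inv (((PresentedGroup.of (0, false) : SurfaceGroup (n + 3)) : SurfaceGroup (n + 3)) : SurfaceGroup (n + 3) ⧸ (⊤ : Subgroup (SurfaceGroup (n + 3))).lowerCentralSeries 2) (((PresentedGroup.of (0, true) : SurfaceGroup (n + 3)) : SurfaceGroup (n + 3)) : SurfaceGroup (n + 3) ⧸ (⊤ : Subgroup (SurfaceGroup (n + 3))).lowerCentralSeries 2), ← commutatorElement_inv (((PresentedGroup.of (0, false) : SurfaceGroup (n + 3)) : SurfaceGroup (n + 3)) : SurfaceGroup (n + 3) ⧸ (⊤ : Subgroup (SurfaceGroup (n + 3))).lowerCentralSeries 2) (((PresentedGroup.of (1, false) : SurfaceGroup (n + 3)) : SurfaceGroup (n + 3)) : SurfaceGroup (n + 3) ⧸ (⊤ : Subgroup (SurfaceGroup (n + 3))).lowerCentralSeries 2), ← commutatorElement_inv (((PresentedGroup.of (0, false) : SurfaceGroup (n + 3)) : SurfaceGroup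 (n + 3)) : SurfaceGroup (n + 3) ⧸ (⊤ : Subgroup (SurfaceGroup (n + 3))).lowerCentralSeries 2) (((PresentedGroup.of (1, true) : SurfaceGroup (n + 3)) : SurfaceGroup (n + 3)) : SurfaceGroup (n + 3) ⧸ (⊤ : Subgroup (SurfaceGroup (n + 3))).lowerCentralSeries 2), ← commutatorElement_inv (((PresentedGroup.of (0, false) : SurfaceGroup (n + 3)) : SurfaceGroup (n + 3)) : SurfaceGroup (n + 3) ⧸ (⊤ : Subgroup (SurfaceGroup (n + 3))).lowerCentralSeries 2) (((PresentedGroup.of (k, false) : SurfaceGroup (n + 3)) : SurfaceGroup (n + 3)) : SurfaceGroup (n + 3) ⧸ (⊤ : Subgroup (SurfaceGroup (n + 3))).lowerCentralSeries 2), ← commutatorElement_inv (((PresentedGroup.of (0, false) : SurfaceGroup (n + 3)) : SurfaceGroup (n + 3)) : SurfaceGroup (n + 3) ⧸ (⊤ : Subgroup (SurfaceGroup (n + 3))).lowerCentralSeries 2) (((PresentedGroup.of (k, true) : SurfaceGroup (n + 3)) : SurfaceGroup (n + 3)) : SurfaceGroup (n + 3) ⧸ (⊤ : Subgroup (SurfaceGroup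 (n + 3))).lowerCentralSeries 2), ← commutatorElement_inv (((PresentedGroup.of (0, true) : SurfaceGroup (n + 3)) : SurfaceGroup (n + 3)) : SurfaceGroup (n + 3) ⧸ (⊤ : Subgroup (SurfaceGroup (n + 3))).lowerCentralSeries 2) (((PresentedGroup.of (1, false) : SurfaceGroup (n + 3)) : SurfaceGroup (n + 3)) : SurfaceGroup (n + 3) ⧸ (⊤ : Subgroup (SurfaceGroup (n + 3))).lowerCentralSeries 2), ← commutatorElement_inv (((PresentedGroup.of (0, true) : SurfaceGroup (n + 3)) : SurfaceGroup (n + 3)) : SurfaceGroup (n + 3) ⧸ (⊤ : Subgroup (SurfaceGroup (n + 3))).lowerCentralSeries 2) (((PresentedGroup.of (1, true) : SurfaceGroup (n + 3)) : SurfaceGroup (n + 3)) : SurfaceGroup (n + 3) ⧸ (⊤ : Subgroup (SurfaceGroup (n + 3))).lowerCentralSeries 2), ← commutatorElement_inv (((PresentedGroup.of (0, true) : SurfaceGroup (n + 3)) : SurfaceGroup (n + 3)) : SurfaceGroup (n + 3) ⧸ (⊤ : Subgroup (SurfaceGroup (n + 3))).lowerCentralSeries 2) (((PresentedGroup.of (k,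 false) : SurfaceGroup (n + 3)) : SurfaceGroup (n + 3)) : SurfaceGroup (n + 3) ⧸ (⊤ : Subgroup (SurfaceGroup (n + 3))).lowerCentralSeries 2), ← commutatorElement_inv (((PresentedGroup.of (0, true) : SurfaceGroup (n + 3)) : SurfaceGroup (n + 3)) : SurfaceGroup (n + 3) ⧸ (⊤ : Subgroup (SurfaceGroup (n + 3))).lowerCentralSeries 2) (((PresentedGroup.of (k, true) : SurfaceGroup (n + 3)) : SurfaceGroup (n + 3)) : SurfaceGroup (n + 3) ⧸ (⊤ : Subgroup (SurfaceGroup (n + 3))).lowerCentralSeries 2), ← commutatorElement_inv (((PresentedGroup.of (1, false) : SurfaceGroup (n + 3)) : SurfaceGroup (n + 3)) : SurfaceGroup (n + 3) ⧸ (⊤ : Subgroup (SurfaceGroup (n + 3))).lowerCentralSeries 2) (((PresentedGroup.of (1, true) : SurfaceGroup (n + 3)) : SurfaceGroup (n + 3)) : SurfaceGroup (n + 3) ⧸ (⊤ : Subgroup (SurfaceGroup (n + 3))).lowerCentralSeries 2), ← commutatorElement_inv (((PresentedGroup.of (1, false) : SurfaceGroup (n + 3)) : SurfaceGroup (n + 3))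 : SurfaceGroup (n + 3) ⧸ (⊤ : Subgroup (SurfaceGroup (n + 3))).lowerCentralSeries 2) (((PresentedGroup.of (k, false) : SurfaceGroup (n + 3)) : SurfaceGroup (n + 3)) : SurfaceGroup (n + 3) ⧸ (⊤ : Subgroup (SurfaceGroup (n + 3))).lowerCentralSeries 2), ← commutatorElement_inv (((PresentedGroup.of (1, false) : SurfaceGroup (n + 3)) : SurfaceGroup (n + 3)) : SurfaceGroup (n + 3) ⧸ (⊤ : Subgroup (SurfaceGroup (n + 3))).lowerCentralSeries 2) (((PresentedGroup.of (k, true) : SurfaceGroup (n + 3)) : SurfaceGroup (n + 3)) : SurfaceGroup (n + 3) ⧸ (⊤ : Subgroup (SurfaceGroup (n + 3))).lowerCentralSeries 2), ← commutatorElement_inv (((PresentedGroup.of (1, true) : SurfaceGroup (n + 3)) : SurfaceGroup (n + 3)) : SurfaceGroup (n + 3) ⧸ (⊤ : Subgroup (SurfaceGroup (n + 3))).lowerCentralSeries 2) (((PresentedGroup.of (k, false) : SurfaceGroup (n + 3)) : SurfaceGroup (n + 3)) : SurfaceGroup (n + 3) ⧸ (⊤ : Subgroup (SurfaceGroup (n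 + 3))).lowerCentralSeries 2), ← commutatorElement_inv (((PresentedGroup.of (1, true) : SurfaceGroup (n + 3)) : SurfaceGroup (n + 3)) : SurfaceGroup (n + 3) ⧸ (⊤ : Subgroup (SurfaceGroup (n + 3))).lowerCentralSeries 2) (((PresentedGroup.of (k, true) : SurfaceGroup (n + 3)) : SurfaceGroup (n + 3)) : SurfaceGroup (n + 3) ⧸ (⊤ : Subgroup (SurfaceGroup (n + 3))).lowerCentralSeries 2), ← commutatorElement_inv (((PresentedGroup.of (k, false) : SurfaceGroup (n + 3)) : SurfaceGroup (n + 3)) : SurfaceGroup (n + 3) ⧸ (⊤ : Subgroup (SurfaceGroup (n + 3))).lowerCentralSeries 2) (((PresentedGroup.of (k, true) : SurfaceGroup (n + 3)) : SurfaceGroup (n + 3)) : SurfaceGroup (n + 3) ⧸ (⊤ : Subgroup (SurfaceGroup (n + 3))).lowerCentralSeries 2), inv_inv, mul_inv_rev, inv_one, mul_one, one_mul]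
      obtain ⟨f, hf⟩ : ∃ f : SurfaceGroup (n + 3) ⧸ (⊤ : Subgroup (SurfaceGroup (n + 3))).lowerCentralSeries 2 → SurfaceGroup (n + 3) ⧸ (⊤ : Subgroup (SurfaceGroup (n + 3))).lowerCentralSeries 2 →
          Subgroup.center (SurfaceGroup (n + 3) ⧸ (⊤ : Subgroup (SurfaceGroup (n + 3))).lowerCentralSeries 2), ∀ a b, ((f a b : Subgroup.center (SurfaceGroup (n + 3) ⧸ (⊤ : Subgroup (SurfaceGroup (n + 3))).lowerCentralSeries 2)) : SurfaceGroup (n + 3) ⧸ (⊤ : Subgroup (SurfaceGroup (n + 3))).lowerCentralSeries 2) = ⁅a, b⁆ :=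
        ⟨fun a b => ⟨⁅a, b⁆, c2_mem_center quot_class_two a b⟩, fun _ _ => rfl⟩
      simp only [← hf, ← Subgroup.coe_mul, ← Subgroup.coe_inv]
      try rw [← Subgroup.coe_one (Subgroup.center _)]
      rw [Subtype.coe_inj]
      open scoped IsMulCommutative in (apply Additive.ofMul.injective; simp only [ofMul_mul, ofMul_inv, ofMul_one]; abel)
    · rw [hθ, sB1, quot_triple]
      simp only [ia_quot_mul hψ, ia_quot_inv hψ, tA0, tB0, tA1, tB1, tAk, tBk]
      simp only [h10, h01, hk0, hk1, h0k, h1k, and_true, and_false, true_and, false_and, if_true, if_false, Bool.false_eq_true, Bool.true_eq_false, eq_self_iff_true, ne_eq, not_false_eq_true, not_true_eq_false, zpow_zero, zpow_one, zpow_neg, mul_one, one_mul, inv_one, mul_inv_rev, inv_inv]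
      simp only [map_mul, map_inv, map_one, map_commutatorElement]
      simp only [QuotientGroup.map_mk, MulEquiv.coe_toMonoidHom]
      simp only [mA0, mB0, mA1, mB1, mAk, mBk]
      simp only [QuotientGroup.mk_mul, QuotientGroup.mk_inv, QuotientGroup.mk_one, quot_commutatorElement]
      simp only [c2_mul_left quot_class_two, c2_mul_right quot_class_two, c2_inv_left quot_class_two, c2_inv_right quot_class_two, commutatorElement_self, commutatorElement_one_left, commutatorElement_one_right]
      simp only [← commutatorElement_inv (((PresentedGroup.of (0, false) : SurfaceGroup (n + 3)) : SurfaceGroup (n + 3)) : SurfaceGroup (n + 3) ⧸ (⊤ : Subgroup (SurfaceGroup (n + 3))).lowerCentralSeries 2) (((PresentedGroup.of (0, true) : SurfaceGroup (n + 3)) : SurfaceGroup (n + 3)) : SurfaceGroup (n + 3) ⧸ (⊤ : Subgroup (SurfaceGroup (n + 3))).lowerCentralSeries 2), ← commutatorElement_inv (((PresentedGroup.of (0, false) : SurfaceGroup (n + 3)) : SurfaceGroup (n + 3)) : SurfaceGroup (n + 3) ⧸ (⊤ : Subgroup (SurfaceGroup (n + 3))).lowerCentralSeries 2) (((PresentedGroup.of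 (1, false) : SurfaceGroup (n + 3)) : SurfaceGroup (n + 3)) : SurfaceGroup (n + 3) ⧸ (⊤ : Subgroup (SurfaceGroup (n + 3))).lowerCentralSeries 2), ← commutatorElement_inv (((PresentedGroup.of (0, false) : SurfaceGroup (n + 3)) : SurfaceGroup (n + 3)) : SurfaceGroup (n + 3) ⧸ (⊤ : Subgroup (SurfaceGroup (n + 3))).lowerCentralSeries 2) (((PresentedGroup.of (1, true) : SurfaceGroup (n + 3)) : SurfaceGroup (n + 3)) : SurfaceGroup (n + 3) ⧸ (⊤ : Subgroup (SurfaceGroup (n + 3))).lowerCentralSeries 2), ← commutatorElement_inv (((PresentedGroup.of (0, false) : SurfaceGroup (n + 3)) : SurfaceGroup (n + 3)) : SurfaceGroup (n + 3) ⧸ (⊤ : Subgroup (SurfaceGroup (n + 3))).lowerCentralSeries 2) (((PresentedGroup.of (k, false) : SurfaceGroup (n + 3)) : SurfaceGroup (n + 3)) : SurfaceGroup (n + 3) ⧸ (⊤ : Subgroup (SurfaceGroup (n + 3))).lowerCentralSeries 2), ← commutatorElement_inv (((PresentedGroup.of (0, false) : SurfaceGroup (n + 3)) : SurfaceGroup (n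 + 3)) : SurfaceGroup (n + 3) ⧸ (⊤ : Subgroup (SurfaceGroup (n + 3))).lowerCentralSeries 2) (((PresentedGroup.of (k, true) : SurfaceGroup (n + 3)) : SurfaceGroup (n + 3)) : SurfaceGroup (n + 3) ⧸ (⊤ : Subgroup (SurfaceGroup (n + 3))).lowerCentralSeries 2), ← commutatorElement_inv (((PresentedGroup.of (0, true) : SurfaceGroup (n + 3)) : SurfaceGroup (n + 3)) : SurfaceGroup (n + 3) ⧸ (⊤ : Subgroup (SurfaceGroup (n + 3))).lowerCentralSeries 2) (((PresentedGroup.of (1, false) : SurfaceGroup (n + 3)) : SurfaceGroup (n + 3)) : SurfaceGroup (n + 3) ⧸ (⊤ : Subgroup (SurfaceGroup (n + 3))).lowerCentralSeries 2), ← commutatorElement_inv (((PresentedGroup.of (0, true) : SurfaceGroup (n + 3)) : SurfaceGroup (n + 3)) : SurfaceGroup (n + 3) ⧸ (⊤ : Subgroup (SurfaceGroup (n + 3))).lowerCentralSeries 2) (((PresentedGroup.of (1, true) : SurfaceGroup (n + 3)) : SurfaceGroup (n + 3)) : SurfaceGroup (n + 3) ⧸ (⊤ : Subgroup (SurfaceGroup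 (n + 3))).lowerCentralSeries 2), ← commutatorElement_inv (((PresentedGroup.of (0, true) : SurfaceGroup (n + 3)) : SurfaceGroup (n + 3)) : SurfaceGroup (n + 3) ⧸ (⊤ : Subgroup (SurfaceGroup (n + 3))).lowerCentralSeries 2) (((PresentedGroup.of (k, false) : SurfaceGroup (n + 3)) : SurfaceGroup (n + 3)) : SurfaceGroup (n + 3) ⧸ (⊤ : Subgroup (SurfaceGroup (n + 3))).lowerCentralSeries 2), ← commutatorElement_inv (((PresentedGroup.of (0, true) : SurfaceGroup (n + 3)) : SurfaceGroup (n + 3)) : SurfaceGroup (n + 3) ⧸ (⊤ : Subgroup (SurfaceGroup (n + 3))).lowerCentralSeries 2) (((PresentedGroup.of (k, true) : SurfaceGroup (n + 3)) : SurfaceGroup (n + 3)) : SurfaceGroup (n + 3) ⧸ (⊤ : Subgroup (SurfaceGroup (n + 3))).lowerCentralSeries 2), ← commutatorElement_inv (((PresentedGroup.of (1, false) : SurfaceGroup (n + 3)) : SurfaceGroup (n + 3)) : SurfaceGroup (n + 3) ⧸ (⊤ : Subgroup (SurfaceGroup (n + 3))).lowerCentralSeries 2) (((PresentedGroup.of (1,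 true) : SurfaceGroup (n + 3)) : SurfaceGroup (n + 3)) : SurfaceGroup (n + 3) ⧸ (⊤ : Subgroup (SurfaceGroup (n + 3))).lowerCentralSeries 2), ← commutatorElement_inv (((PresentedGroup.of (1, false) : SurfaceGroup (n + 3)) : SurfaceGroup (n + 3)) : SurfaceGroup (n + 3) ⧸ (⊤ : Subgroup (SurfaceGroup (n + 3))).lowerCentralSeries 2) (((PresentedGroup.of (k, false) : SurfaceGroup (n + 3)) : SurfaceGroup (n + 3)) : SurfaceGroup (n + 3) ⧸ (⊤ : Subgroup (SurfaceGroup (n + 3))).lowerCentralSeries 2), ← commutatorElement_inv (((PresentedGroup.of (1, false) : SurfaceGroup (n + 3)) : SurfaceGroup (n + 3)) : SurfaceGroup (n + 3) ⧸ (⊤ : Subgroup (SurfaceGroup (n + 3))).lowerCentralSeries 2) (((PresentedGroup.of (k, true) : SurfaceGroup (n + 3)) : SurfaceGroup (n + 3)) : SurfaceGroup (n + 3) ⧸ (⊤ : Subgroup (SurfaceGroup (n + 3))).lowerCentralSeries 2), ← commutatorElement_inv (((PresentedGroup.of (1, true) : SurfaceGroup (n + 3)) : SurfaceGroup (n + 3))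 : SurfaceGroup (n + 3) ⧸ (⊤ : Subgroup (SurfaceGroup (n + 3))).lowerCentralSeries 2) (((PresentedGroup.of (k, false) : SurfaceGroup (n + 3)) : SurfaceGroup (n + 3)) : SurfaceGroup (n + 3) ⧸ (⊤ : Subgroup (SurfaceGroup (n + 3))).lowerCentralSeries 2), ← commutatorElement_inv (((PresentedGroup.of (1, true) : SurfaceGroup (n + 3)) : SurfaceGroup (n + 3)) : SurfaceGroup (n + 3) ⧸ (⊤ : Subgroup (SurfaceGroup (n + 3))).lowerCentralSeries 2) (((PresentedGroup.of (k, true) : SurfaceGroup (n + 3)) : SurfaceGroup (n + 3)) : SurfaceGroup (n + 3) ⧸ (⊤ : Subgroup (SurfaceGroup (n + 3))).lowerCentralSeries 2), ← commutatorElement_inv (((PresentedGroup.of (k, false) : SurfaceGroup (n + 3)) : SurfaceGroup (n + 3)) : SurfaceGroup (n + 3) ⧸ (⊤ : Subgroup (SurfaceGroup (n + 3))).lowerCentralSeries 2) (((PresentedGroup.of (k, true) : SurfaceGroup (n + 3)) : SurfaceGroup (n + 3)) : SurfaceGroup (n + 3) ⧸ (⊤ : Subgroup (SurfaceGroup (n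 + 3))).lowerCentralSeries 2), inv_inv, mul_inv_rev, inv_one, mul_one, one_mul]
      obtain ⟨f, hf⟩ : ∃ f : SurfaceGroup (n + 3) ⧸ (⊤ : Subgroup (SurfaceGroup (n + 3))).lowerCentralSeries 2 → SurfaceGroup (n + 3) ⧸ (⊤ : Subgroup (SurfaceGroup (n + 3))).lowerCentralSeries 2 →
          Subgroup.center (SurfaceGroup (n + 3) ⧸ (⊤ : Subgroup (SurfaceGroup (n + 3))).lowerCentralSeries 2), ∀ a b, ((f a b : Subgroup.center (SurfaceGroup (n + 3) ⧸ (⊤ : Subgroup (SurfaceGroup (n + 3))).lowerCentralSeries 2)) : SurfaceGroup (n + 3) ⧸ (⊤ : Subgroup (SurfaceGroup (n + 3))).lowerCentralSeries 2) = ⁅a, b⁆ :=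
        ⟨fun a b => ⟨⁅a, b⁆, c2_mem_center quot_class_two a b⟩, fun _ _ => rfl⟩
      simp only [← hf, ← Subgroup.coe_mul, ← Subgroup.coe_inv]
      try rw [← Subgroup.coe_one (Subgroup.center _)]
      rw [Subtype.coe_inj]
      open scoped IsMulCommutative in (apply Additive.ofMul.injective; simp only [ofMul_mul, ofMul_inv, ofMul_one]; abel)
  by_cases hkj : k = j
  · subst hkj
    cases ε
    · rw [hθ, sne k false hj0 hj1, quot_triple]
      simp only [ia_quot_mul hψ, ia_quot_inv hψ, tA0, tB0, tA1, tB1, tAk, tBk]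
      simp only [h10, h01, hk0, hk1, h0k, h1k, and_true, and_false, true_and, false_and, if_true, if_false, Bool.false_eq_true, Bool.true_eq_false, eq_self_iff_true, ne_eq, not_false_eq_true, not_true_eq_false, zpow_zero, zpow_one, zpow_neg, mul_one, one_mul, inv_one, mul_inv_rev, inv_inv]
      simp only [map_mul, map_inv, map_one, map_commutatorElement]
      simp only [QuotientGroup.map_mk, MulEquiv.coe_toMonoidHom]
      simp only [mA0, mB0, mA1, mB1, mAk, mBk]
      simp only [QuotientGroup.mk_mul, QuotientGroup.mk_inv, QuotientGroup.mk_one, quot_commutatorElement]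
      simp only [c2_mul_left quot_class_two, c2_mul_right quot_class_two, c2_inv_left quot_class_two, c2_inv_right quot_class_two, commutatorElement_self, commutatorElement_one_left, commutatorElement_one_right]
      simp only [← commutatorElement_inv (((PresentedGroup.of (0, false) : SurfaceGroup (n + 3)) : SurfaceGroup (n + 3)) : SurfaceGroup (n + 3) ⧸ (⊤ : Subgroup (SurfaceGroup (n + 3))).lowerCentralSeries 2) (((PresentedGroup.of (0, true) : SurfaceGroup (n + 3)) : SurfaceGroup (n + 3)) : SurfaceGroup (n + 3) ⧸ (⊤ : Subgroup (SurfaceGroup (n + 3))).lowerCentralSeries 2), ← commutatorElement_inv (((PresentedGroup.of (0, false) : SurfaceGroup (n + 3)) : SurfaceGroup (n + 3)) : SurfaceGroup (n + 3) ⧸ (⊤ : Subgroup (SurfaceGroup (n + 3))).lowerCentralSeries 2) (((PresentedGroup.of (1, false) : SurfaceGroup (n + 3)) : SurfaceGroup (n + 3)) : SurfaceGroup (n + 3) ⧸ (⊤ : Subgroup (SurfaceGroup (n + 3))).lowerCentralSeries 2), ← commutatorElement_inv (((PresentedGroup.of (0, false) : SurfaceGroup (n + 3)) : SurfaceGroup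 (n + 3)) : SurfaceGroup (n + 3) ⧸ (⊤ : Subgroup (SurfaceGroup (n + 3))).lowerCentralSeries 2) (((PresentedGroup.of (1, true) : SurfaceGroup (n + 3)) : SurfaceGroup (n + 3)) : SurfaceGroup (n + 3) ⧸ (⊤ : Subgroup (SurfaceGroup (n + 3))).lowerCentralSeries 2), ← commutatorElement_inv (((PresentedGroup.of (0, false) : SurfaceGroup (n + 3)) : SurfaceGroup (n + 3)) : SurfaceGroup (n + 3) ⧸ (⊤ : Subgroup (SurfaceGroup (n + 3))).lowerCentralSeries 2) (((PresentedGroup.of (k, false) : SurfaceGroup (n + 3)) : SurfaceGroup (n + 3)) : SurfaceGroup (n + 3) ⧸ (⊤ : Subgroup (SurfaceGroup (n + 3))).lowerCentralSeries 2), ← commutatorElement_inv (((PresentedGroup.of (0, false) : SurfaceGroup (n + 3)) : SurfaceGroup (n + 3)) : SurfaceGroup (n + 3) ⧸ (⊤ : Subgroup (SurfaceGroup (n + 3))).lowerCentralSeries 2) (((PresentedGroup.of (k, true) : SurfaceGroup (n + 3)) : SurfaceGroup (n + 3)) : SurfaceGroup (n + 3) ⧸ (⊤ : Subgroup (SurfaceGroup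 (n + 3))).lowerCentralSeries 2), ← commutatorElement_inv (((PresentedGroup.of (0, true) : SurfaceGroup (n + 3)) : SurfaceGroup (n + 3)) : SurfaceGroup (n + 3) ⧸ (⊤ : Subgroup (SurfaceGroup (n + 3))).lowerCentralSeries 2) (((PresentedGroup.of (1, false) : SurfaceGroup (n + 3)) : SurfaceGroup (n + 3)) : SurfaceGroup (n + 3) ⧸ (⊤ : Subgroup (SurfaceGroup (n + 3))).lowerCentralSeries 2), ← commutatorElement_inv (((PresentedGroup.of (0, true) : SurfaceGroup (n + 3)) : SurfaceGroup (n + 3)) : SurfaceGroup (n + 3) ⧸ (⊤ : Subgroup (SurfaceGroup (n + 3))).lowerCentralSeries 2) (((PresentedGroup.of (1, true) : SurfaceGroup (n + 3)) : SurfaceGroup (n + 3)) : SurfaceGroup (n + 3) ⧸ (⊤ : Subgroup (SurfaceGroup (n + 3))).lowerCentralSeries 2), ← commutatorElement_inv (((PresentedGroup.of (0, true) : SurfaceGroup (n + 3)) : SurfaceGroup (n + 3)) : SurfaceGroup (n + 3) ⧸ (⊤ : Subgroup (SurfaceGroup (n + 3))).lowerCentralSeries 2) (((PresentedGroup.of (k,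 false) : SurfaceGroup (n + 3)) : SurfaceGroup (n + 3)) : SurfaceGroup (n + 3) ⧸ (⊤ : Subgroup (SurfaceGroup (n + 3))).lowerCentralSeries 2), ← commutatorElement_inv (((PresentedGroup.of (0, true) : SurfaceGroup (n + 3)) : SurfaceGroup (n + 3)) : SurfaceGroup (n + 3) ⧸ (⊤ : Subgroup (SurfaceGroup (n + 3))).lowerCentralSeries 2) (((PresentedGroup.of (k, true) : SurfaceGroup (n + 3)) : SurfaceGroup (n + 3)) : SurfaceGroup (n + 3) ⧸ (⊤ : Subgroup (SurfaceGroup (n + 3))).lowerCentralSeries 2), ← commutatorElement_inv (((PresentedGroup.of (1, false) : SurfaceGroup (n + 3)) : SurfaceGroup (n + 3)) : SurfaceGroup (n + 3) ⧸ (⊤ : Subgroup (SurfaceGroup (n + 3))).lowerCentralSeries 2) (((PresentedGroup.of (1, true) : SurfaceGroup (n + 3)) : SurfaceGroup (n + 3)) : SurfaceGroup (n + 3) ⧸ (⊤ : Subgroup (SurfaceGroup (n + 3))).lowerCentralSeries 2), ← commutatorElement_inv (((PresentedGroup.of (1, false) : SurfaceGroup (n + 3)) : SurfaceGroup (n + 3))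 : SurfaceGroup (n + 3) ⧸ (⊤ : Subgroup (SurfaceGroup (n + 3))).lowerCentralSeries 2) (((PresentedGroup.of (k, false) : SurfaceGroup (n + 3)) : SurfaceGroup (n + 3)) : SurfaceGroup (n + 3) ⧸ (⊤ : Subgroup (SurfaceGroup (n + 3))).lowerCentralSeries 2), ← commutatorElement_inv (((PresentedGroup.of (1, false) : SurfaceGroup (n + 3)) : SurfaceGroup (n + 3)) : SurfaceGroup (n + 3) ⧸ (⊤ : Subgroup (SurfaceGroup (n + 3))).lowerCentralSeries 2) (((PresentedGroup.of (k, true) : SurfaceGroup (n + 3)) : SurfaceGroup (n + 3)) : SurfaceGroup (n + 3) ⧸ (⊤ : Subgroup (SurfaceGroup (n + 3))).lowerCentralSeries 2), ← commutatorElement_inv (((PresentedGroup.of (1, true) : SurfaceGroup (n + 3)) : SurfaceGroup (n + 3)) : SurfaceGroup (n + 3) ⧸ (⊤ : Subgroup (SurfaceGroup (n + 3))).lowerCentralSeries 2) (((PresentedGroup.of (k, false) : SurfaceGroup (n + 3)) : SurfaceGroup (n + 3)) : SurfaceGroup (n + 3) ⧸ (⊤ : Subgroup (SurfaceGroup (n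 + 3))).lowerCentralSeries 2), ← commutatorElement_inv (((PresentedGroup.of (1, true) : SurfaceGroup (n + 3)) : SurfaceGroup (n + 3)) : SurfaceGroup (n + 3) ⧸ (⊤ : Subgroup (SurfaceGroup (n + 3))).lowerCentralSeries 2) (((PresentedGroup.of (k, true) : SurfaceGroup (n + 3)) : SurfaceGroup (n + 3)) : SurfaceGroup (n + 3) ⧸ (⊤ : Subgroup (SurfaceGroup (n + 3))).lowerCentralSeries 2), ← commutatorElement_inv (((PresentedGroup.of (k, false) : SurfaceGroup (n + 3)) : SurfaceGroup (n + 3)) : SurfaceGroup (n + 3) ⧸ (⊤ : Subgroup (SurfaceGroup (n + 3))).lowerCentralSeries 2) (((PresentedGroup.of (k, true) : SurfaceGroup (n + 3)) : SurfaceGroup (n + 3)) : SurfaceGroup (n + 3) ⧸ (⊤ : Subgroup (SurfaceGroup (n + 3))).lowerCentralSeries 2), inv_inv, mul_inv_rev, inv_one, mul_one, one_mul]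
      obtain ⟨f, hf⟩ : ∃ f : SurfaceGroup (n + 3) ⧸ (⊤ : Subgroup (SurfaceGroup (n + 3))).lowerCentralSeries 2 → SurfaceGroup (n + 3) ⧸ (⊤ : Subgroup (SurfaceGroup (n + 3))).lowerCentralSeries 2 →
          Subgroup.center (SurfaceGroup (n + 3) ⧸ (⊤ : Subgroup (SurfaceGroup (n + 3))).lowerCentralSeries 2), ∀ a b, ((f a b : Subgroup.center (SurfaceGroup (n + 3) ⧸ (⊤ : Subgroup (SurfaceGroup (n + 3))).lowerCentralSeries 2)) : SurfaceGroup (n + 3) ⧸ (⊤ : Subgroup (SurfaceGroup (n + 3))).lowerCentralSeries 2) = ⁅a, b⁆ :=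
        ⟨fun a b => ⟨⁅a, b⁆, c2_mem_center quot_class_two a b⟩, fun _ _ => rfl⟩
      simp only [← hf, ← Subgroup.coe_mul, ← Subgroup.coe_inv]
      try rw [← Subgroup.coe_one (Subgroup.center _)]
      rw [Subtype.coe_inj]
      open scoped IsMulCommutative in (apply Additive.ofMul.injective; simp only [ofMul_mul, ofMul_inv, ofMul_one]; abel)
    · rw [hθ, sne k true hj0 hj1, hτq, quot_triple, quot_triple]
      simp only [h10, h01, hk0, hk1, h0k, h1k, and_true, and_false, true_and, false_and, if_true, if_false, Bool.false_eq_true, Bool.true_eq_false, eq_self_iff_true, ne_eq, not_false_eq_true, not_true_eq_false, zpow_zero, zpow_one, zpow_neg, mul_one, one_mul, inv_one, mul_inv_rev, inv_inv, map_one, mul_one]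
  · have hjk : j ≠ k := fun h => hkj h.symm
    rw [hθ, sne j ε hj0 hj1, hτq, quot_triple, quot_triple]
    simp only [h10, h01, hk0, hk1, h0k, h1k, hj0, hj1, hjk, hkj, and_true, and_false, true_and, false_and, if_true, if_false, Bool.false_eq_true, Bool.true_eq_false, eq_self_iff_true, ne_eq, not_false_eq_true, not_true_eq_false, zpow_zero, zpow_one, zpow_neg, mul_one, one_mul, inv_one, mul_inv_rev, inv_inv, map_one, mul_one]

end Mixing

/-- **Registered helper**: the bounding-pair map realises `(b₀, a₀, b₁)` in every `S_{n+3}` (`τ₁ = b₀ ∧ a₀ ∧ b₁`). [cite: Johnson1980AbelianQuotient, Lemma 4B] -/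
theorem helper_johnsonBoundingPair : ∀ (n : ℕ), ∃ ψ : Literature.Topology.FourManifolds.SurfaceGroup (n + 3) ≃* Literature.Topology.FourManifolds.SurfaceGroup (n + 3), (∀ s : Literature.Topology.FourManifolds.SurfaceGroup (n + 3), ψ s * s⁻¹ ∈ (⊤ : Subgroup (Literature.Topology.FourManifolds.SurfaceGroup (n + 3))).lowerCentralSeries 1) ∧ ∀ x : Fin (n + 3) × Bool, ψ (PresentedGroup.of x : Literature.Topology.FourManifolds.SurfaceGroup (n + 3)) * (PresentedGroup.of x : Literature.Topology.FourManifolds.SurfaceGroup (n + 3))⁻¹ * (⁅(PresentedGroup.of ((0 : Fin (n + 3)), false) : Literature.Topology.FourManifolds.SurfaceGroup (n + 3)), (PresentedGroup.of ((1 : Fin (n + 3)), true) : Literature.Topology.FourManifolds.SurfaceGroup (n + 3))⁆ ^ (if x.1 = ((0 : Fin (n + 3)), true).1 ∧ x.2 = false ∧ ((0 : Fin (n + 3)), true).2 = true then (1 : ℤ) else if x.1 = ((0 : Fin (n + 3)), true).1 ∧ x.2 = true ∧ ((0 : Fin (n + 3)), true).2 = false then (-1 : ℤ) else 0) * ⁅(PresentedGroup.of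 ((1 : Fin (n + 3)), true) : Literature.Topology.FourManifolds.SurfaceGroup (n + 3)), (PresentedGroup.of ((0 : Fin (n + 3)), true) : Literature.Topology.FourManifolds.SurfaceGroup (n + 3))⁆ ^ (if x.1 = ((0 : Fin (n + 3)), false).1 ∧ x.2 = false ∧ ((0 : Fin (n + 3)), false).2 = true then (1 : ℤ) else if x.1 = ((0 : Fin (n + 3)), false).1 ∧ x.2 = true ∧ ((0 : Fin (n + 3)), false).2 = false then (-1 : ℤ) else 0) * ⁅(PresentedGroup.of ((0 : Fin (n + 3)), true) : Literature.Topology.FourManifolds.SurfaceGroup (n + 3)), (PresentedGroup.of ((0 : Fin (n + 3)), false) : Literature.Topology.FourManifolds.SurfaceGroup (n + 3))⁆ ^ (if x.1 = ((1 : Fin (n + 3)), true).1 ∧ x.2 = false ∧ ((1 : Fin (n + 3)), true).2 = true then (1 : ℤ) else if x.1 = ((1 : Fin (n + 3)), true).1 ∧ x.2 = true ∧ ((1 : Fin (n + 3)), true).2 = false then (-1 : ℤ) else 0))⁻¹ ∈ (⊤ : Subgroup (Literature.Topology.FourManifolds.SurfaceGroup (n + 3))).lowerCentralSeries 2 :=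 by
  intro n
  exact realise_bp n

end Summit.SmoothPoincare4.SmoothPoincare4.Theorems.NilpotentShadowsStandard.SaturatedTorsorDescent
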